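/-
Copyright (c) 2026 the pub-hodgecm-mathlib formalisation cell (harness21).  Prover seat hodgecm-mathlib-K2E1-p15 (g5) ((V) OF RECORD KEEPER from ED. 14: K2E1-p15 (g4) ED. 14–16, (g5) ED. 17; ED. 9–13 by
R90-C133-p02 (g2), ED. 2–8 by K2E1-p16 (g3) ∕ K2E1-p15 (g4); Track B ∕ K2-LIT), h413 = `stmt-HodgeConjecture-24833`, R90-TF section S8 «ContSpec-n½», socket B MID :358 «(V) OF RECORD
ED. 17» (S8 dealer R90-CS-plan (g4): S8-R256 (1)(M2) «RE-KEY `(S,T′)` to the `S₀`-currency», S8-R259, S8-R272 (3)): ED. 16's CONTENT with the partial `L`-ratio `c_S` of the unfolding letter `hunfK`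
and of the source letter `hsrc` READ AT `(S, T′) := ({w ∣ w|_{L⁺} ∈ S₀}, S₀)` — the currency in which the payers ★ p864886 `hunfK_of_core` and ★ p864821 `hsrc_of_record_at_basePoint_of_core`
(∘ K2E1-p13's `hsrc16_…` assembler) are written — instead of ED. 9's `((ξ.bcη⁻¹·μω).ramifiedPlaces, ∅)`.  Since ED. 9–16 hard-wire the old currency inside ★ `resGMidBlock_ne_bot_of_record_v13`,
this edition RE-RUNS ED. 13's body over ★ p864046 `resGMidBlock_ne_bot_of_ledger_letters` (generic in `S T′`) with ED. 14–16's bindings (nothing re-proved: every row is called BY NAME).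
-/
import Summits.HodgeConjecture.HodgeConjecture.Theorems.R90S8ResGMidBlockNeBotOfRecordV13U3     -- ★ p864963 (R90-C133-p02 (g2)): ED. 13 — imported for its BODY's suppliers (★ p864046 ED. 2, ★ ED. 12 §1 `rowTwo_of_coordRoad`, ★ p864823, ★ `ledgerLetters_of_exports`, ★ `hE6_midWitness`, level lemmas, A32 files, twist files, ★ NeBotAssembly §1)
import Summits.HodgeConjecture.HodgeConjecture.Theorems.K2E1ChiAxisRealityOfRecordCMThree       -- ★ p864973 (K2E1-p15 (g4)): `hreal_midWitness` (ED. 14's binding)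
import Summits.HodgeConjecture.HodgeConjecture.Theorems.K2E1ChiMS32OfUnfoldingCMThree             -- ★ p865104 (K2E1-p15 (g4)): `hMS32_midWitness_of_unfolding` (ED. 15's binding; generic F4 frame)
import Summits.HodgeConjecture.HodgeConjecture.Theorems.R90S8MidWitnessLevelBlockBasisU3         -- ★ p865115 (K2E1-p13 (g6)): `exists_blockBasis_levelOfRecord` (ED. 16's binding)
import Literature.NumberTheory.Automorphic.PairLFunctionBaseChange                               -- ★ `finite_placesOver` (finitely many places of `L` over a place of `L⁺`)
import HarnessLib

/-!
# S8 socket B MID — `R90S8ResGMidBlockNeBotOfRecordV17U3` ((V) OF RECORD, ED. 17): `LHalfNeZero (ξ.bcη⁻¹·μω) → resGMidBlock L μ ξ μω ≠ ⊥` AT THE LEVEL OF RECORD, the partial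
# `L`-ratio `c_S` of `hunfK` ∕ `hsrc` RE-KEYED to the payers' currency `(S, T′) := (places of L over S₀, S₀)`; new visible binder `hur` (`χ` unramified above `v ∉ S₀`); everything else = ED. 16

Track B ∕ K2-LIT, crux h413 = `stmt-HodgeConjecture-24833`, route of record `HCCMUnconditional`; cell `hodgecm-mathlib`, R90-TF programme, section S8 «ContSpec-n½», socket B MID :358
∕ (V) — since RULING J-S8-M3′ (S8-R260 (b)) the column of record for the SCALAR SUB-ROW (`|m_w| = 1`); the general sub-row is the (V-τ) assembly (K2E1-p14 (g5)).  THEOREMS ONLY (no `def`,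
no `instance`, no `notation`, no named-fact hypothesis, no `sorry`; default heartbeats); lane `--supports stmt-HodgeConjecture-24833 --as helper` (count-neutral).  CLOSES NO SOCKET
(OF-RECORD ≠ payment).  ★ p864046 `resGMidBlock_ne_bot_of_ledger_letters` (ED. 2, generic in the ramification sets `S T′` of its row (iii)) is called BY NAME with:
(000000000) NEW IN ED. 17 (S8-R256 (1)(M2), S8-R259, S8-R272 (3)): the RAMIFICATION FRAME of row (iii) and of ★ F4's frame inside ★ `hMSP'_midWitness_of_unfolding` ∕ ★ `hMS32_midWitness_of_unfolding`
is `S := {w ∣ w.under 𝓞_{L⁺} ∈ S₀}` (finite: finitely many places over each `v ∈ S₀`, ★ `finite_placesOver`), `hurφ := hur` (the new binder, read through `PlacesOver`), `T′ := S₀`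
(`Finset.finite_toSet`), `hurη := fun _ _ _ => rfl` (the trivial Hecke character of `L⁺` is unramified everywhere) — so the `c_S` factor displayed in `hunfK` and in `hsrc` is
`L^S(z−1, χ)·L^{S₀}(2z−2, 1) ∕ (L^S(z, χ)·L^{S₀}(2z−1, 1))` with `S` the places of `L` over `S₀`, i.e. ★ p864886's ∕ ★ p864821's conclusion bytes (their `S₀`, `hgood`); the binder `S₀`
(already the index set of `A`'s finite part since ED. 9) moves in front of `hunfK`; NEW VISIBLE: `hur : ∀ v ∉ S₀, ∀ w ∣ v, χ.IsUnramifiedAt w` = ★ (a-2b)'s `hgood` SECOND HALF verbatim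
(payer: ★ `hgood_unfoldingBadPlaces … hφ𝔫 |>.2` at `S₀ := unfoldingBadPlaces hδ h𝔫`, or `hgood_of_unfoldingBadPlaces_subset` for any `S₀ ⊇` it); CHANGED BYTES: the `c_S` ratio in `hunfK` and
`hsrc` (two tokens each: `(ξ.bcη⁻¹ * μω).ramifiedPlaces ↦ {w : HeightOneSpectrum (𝓞 L) | w.under (𝓞 ↥(maximalRealSubfield L)) ∈ (↑S₀ : Set (HeightOneSpectrum (𝓞 ↥(maximalRealSubfield L))))}`,
`(∅ : Set (HeightOneSpectrum (𝓞 ↥(maximalRealSubfield L)))) ↦ (↑S₀ : Set (HeightOneSpectrum (𝓞 ↥(maximalRealSubfield L))))`); nothing else.  INSIDE (all BY NAME, as in ED. 14–16):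
`⟨ι', _, _, bV, Mb, hbc, hbM⟩ := exists_blockBasis_levelOfRecord …` (★ p865115, ED. 16) and `hsrc` basis-free read through the exports' clause 2 at `g₁` (`ν 𝓕 = 1`); `hχ₁ := isUnitary_bcηInv_mul`,
`hρ₁ := bcηInv_mul_posRealIdele`, `hφ1 := bcηInv_mul_ne_one` (★ NeBotAssembly §1), `hreal := hreal_midWitness …` (★ p864973, ED. 14); `hMS32 := hMS32_midWitness_of_unfolding … hS hurφ … S₀.finite_toSet … hunfK`
(★ p865104, ED. 15, at the re-keyed frame); then ED. 13's body VERBATIM at the re-keyed frame: exports' clauses, the row-(ii) domain `D` by name, `⟨hbddPK, hbdd32⟩ := ledgerLetters_of_exports … hE6 hMSP′ hMS32`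
with `hMSP′ := hMSP'_midWitness_of_unfolding … hS hurφ isUnitary_one rfl S₀.finite_toSet rfl hφ1 hunfK hreal`, `ω₀`, row (i′) at `T = 1` twisted by `Θ = detChar ξ.ψ`, `⟨a, ha, hQ'⟩ := exists_eulerFactorisation_midWitness … h𝓕1 hunfK`,
ROW (ii) := ★ ED. 12 §1 `rowTwo_of_coordRoad` at `c_S` re-keyed, and the final ★ p864046 call with `hS hurφ S₀.finite_toSet rfl`, the NAMED `A`, ★ `differentiableOn_amplitude_shifted_midBlock`, ★ `hA32_shifted_of_record_at_basePoint_of_modEq`.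
(For (00000000)–(0) and (1)–(3) see ★ p865157 ED. 16's and ★ p864963 ED. 13's docstrings.)
NOT YET IN THIS EDITION (next, when ★): `hsrc := hsrc16_of_coreLetters …` (K2E1-p13 (g6), S8-R270 (1); brings the honest scalar-sub-row binder `hm1 : ∀ w, kμ w − 2·ξ.eη w = ±1` of RULING J-S8-M3′)
and the FRAME PACK (R90-CS-p03 (g4) W0: the ≈ 32 free (F)-binders discharged in-file) — both are typed against THIS edition's binder list (ED. 16's ∪ {`hur`}, `S₀` moved), not ED. 16's.
VISIBLE → PAYER: `hunfK` ⇐ ★ p864886 `hunfK_of_core` ∘ the (W)-core's readings (K2E1-p11 (g6) ledger f14602fa; F0P2-p11 ★ p865032 ∕ p865072) — NOW IN THE SAME CURRENCY (up to `(ν𝓕)⁻¹• = 1•`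
and the pure-tensor spelling of `φ₀`); `hsrc` ⇐ ★ p864821 ∘ ★ p865238 ∘ ★ p865258 (K2E1-p13's `hsrc16_of_coreLetters`, S8-R270 (1)) — SAME CURRENCY; `hur` ⇐ ★ `hgood_unfoldingBadPlaces`;
`μK νI 𝓕I h𝓕I h𝓕1` + the (F) frame ⇐ CS-p03's frame pack; the witness `φ₀ hφ₀V hφ₀c hφ₀M`, `𝔫 h𝔫`, `g₁`, the constants `S₀ C hC ε hε1 hε0 kμ hk δ d νv μE₁ μF₁` ⇐ the (W) lane.
HONEST LABEL: HC_CM is proved only modulo the 7 printed citations (2 remaining named inputs: hLiu418 = `stmt-HodgeConjecture-24832`, h413 = `stmt-HodgeConjecture-24833`) until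
rung 0 closes; OF-RECORD ≠ payment — :358 stays `sorry` in B until every visible row is ★ and instantiated; (V) = scalar sub-row only (J-S8-M3′); SOCKET DIGITS 0∕8; REL ≠ ★ ≠ WRITTEN ≠ BUILT; count-neutral.

## References
* [Rogawski1990] J. D. Rogawski, *Automorphic Representations of Unitary Groups in Three Variables* (1990), §13.3 p. 202, §13.9 (ii) p. 229, §12.1 p. 171.
* [MoeglinWaldspurger1995] C. Mœglin, J.-L. Waldspurger, *Spectral Decomposition and Eisenstein Series* (1995), I.2.17, II.1.7, IV.1.8–IV.1.11, IV.2.3, IV.3.12.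
* [TateThesis1967] J. Tate, *Fourier analysis in number fields and Hecke's zeta-functions*, in Cassels–Fröhlich (1967), Lemma 3.2.1, Thm 3.3.1.
* [BernsteinLapid2019] J. Bernstein, E. Lapid, *On the meromorphic continuation of Eisenstein series*, J. Amer. Math. Soc. 37 (2024), Thm 2.3, §4.
-/
set_option autoImplicit false
set_option linter.dupNamespace false  -- the mandated namespace `…HodgeConjecture.HodgeConjecture.R90.S8` (LEAD #1 L1) repeats the summit's segment

noncomputable section

open MeasureTheory Measure NumberField IsDedekindDomain Set Filter Topology Metric
open scoped ENNReal NNReal MatrixGroups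
open Literature.MeasureTheory.Group Literature.NumberTheory
open Literature.NumberTheory.Automorphic Literature.NumberTheory.Automorphic.UnitaryGroup Literature.NumberTheory.LFunctions Literature.NumberTheory.GaloisRepresentations AdelicGroupData
open Literature.NumberTheory.Automorphic.Arthur2013.Leaves.TECR Literature.NumberTheory.Rogawski1990 ContRepresentation
open Summit.HodgeConjecture.HodgeConjecture.Cruxes.H413.K2E1BorelEisensteinU
open Summit.HodgeConjecture.HodgeConjecture.Cruxes.H413.K2E1BLBorelSpacesU2Defs
open Summit.HodgeConjecture.HodgeConjecture.Cruxes.H413.K2E1BLBorelOperatorsU2Defs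
open Summit.HodgeConjecture.HodgeConjecture.Cruxes.H413.K2E1CharacterEisensteinU2Defs
open Summit.HodgeConjecture.HodgeConjecture.Cruxes.H413.K2E1ChiSectionSpaceU2Defs
open Summit.HodgeConjecture.HodgeConjecture.Cruxes.H413.K2E1CharacterEisensteinU3PairDefs
open Summit.HodgeConjecture.HodgeConjecture.Cruxes.H413.K2E1ChiSectionSpaceU3PairDefs
open Summit.HodgeConjecture.HodgeConjecture.Cruxes.H413.K2E1HeckeLHalfNeZeroDefs (LHalfNeZero)
open Summit.HodgeConjecture.HodgeConjecture.Cruxes.H413.K2E1ChiEisensteinLedgerLettersOfExportsCMThree (ledgerLetters_of_exports)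
open Summit.HodgeConjecture.HodgeConjecture.Cruxes.H413.K2E1ChiArchA32ShiftedOfRecordU3 (hA32_shifted_of_record_at_basePoint_of_modEq)
open Summit.HodgeConjecture.HodgeConjecture.Cruxes.H413.K2E1ChiArchA32DifferentiableU3 (differentiableOn_amplitude_shifted_midBlock)
open Summit.HodgeConjecture.HodgeConjecture.Cruxes.H413.K2E1ChiTruncatedFamilyTransportCMThree (hE6_midWitness)
open Summit.HodgeConjecture.HodgeConjecture.Cruxes.H413.K2E1ChiScatteringCoordsEulerFactorisationCMThree (exists_eulerFactorisation_midWitness hMSP'_midWitness_of_unfolding)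
open Summit.HodgeConjecture.HodgeConjecture.Cruxes.H413.K2E1ChiConstantTermLedgerOfRecordCMThree (ctLedger_of_amplitudeRows_codiscrete)
open Summit.HodgeConjecture.HodgeConjecture.Cruxes.H413.K2E1ChiAmplitudeOfTranslateU3 (amplitudeOfTranslate amplitudeRows_of_coordFactorisation smul_apply_eq_sum_mul_of_sum_smul_eq)
open Summit.HodgeConjecture.HodgeConjecture.Cruxes.H413.K2E1ChiEisensteinConstantTermCMThree (borelConstantTerm_chiPairEisenstein_cm_three_eq_add_mul)
open Summit.HodgeConjecture.HodgeConjecture.Cruxes.H413.K2E1ChiEisensteinMeromorphicExportsM1CMThree (one_apply_torus isAutomorphic_one)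
open Summit.HodgeConjecture.HodgeConjecture.Cruxes.H413.K2E1ChiEisensteinDetTwistU2 (borelConstantTerm_mul_automorphicCharacter)
open Summit.HodgeConjecture.HodgeConjecture.Cruxes.H413.K2E1L2FamilyTwistU (exists_mulCLM_of_norm_le quotFun_mul)
open Summit.HodgeConjecture.HodgeConjecture.Cruxes.H413.K2E1ChiEisensteinDetTwistU2 (truncation_mul_automorphicCharacter)
open Literature.NumberTheory.GaloisRepresentations.IsNonarchimedeanLocalField
open Literature.NumberTheory.Automorphic.UnitaryGroup.AdelicCharactersDetQuasiSplit (antidiagonal_over_det_ne_zero)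
open scoped ComplexConjugate

open Summit.HodgeConjecture.HodgeConjecture.Cruxes.H413.K2E1ChiMS32OfUnfoldingCMThree (hMS32_midWitness_of_unfolding)
open Summit.HodgeConjecture.HodgeConjecture.Cruxes.H413.K2E1ChiAxisRealityOfRecordCMThree (hreal_midWitness)


namespace Summit.HodgeConjecture.HodgeConjecture.R90.S8

variable (L : Type) [Field L] [NumberField L] [IsCMField L]
  [MeasurableSpace (quasiSplit (↥(maximalRealSubfield L)) L (IsCMField.complexConj L) 3).Adelic] [BorelSpace (quasiSplit (↥(maximalRealSubfield L)) L (IsCMField.complexConj L) 3).Adelic]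
  [MeasurableSpace (arch (↥(maximalRealSubfield L)) L (IsCMField.complexConj L) 3 ((StdForm.antidiagonal 3).over L))] [BorelSpace (arch (↥(maximalRealSubfield L)) L (IsCMField.complexConj L) 3 ((StdForm.antidiagonal 3).over L))]
  [MeasurableSpace (finAdelic (↥(maximalRealSubfield L)) L (IsCMField.complexConj L) 3 ((StdForm.antidiagonal 3).over L))] [BorelSpace (finAdelic (↥(maximalRealSubfield L)) L (IsCMField.complexConj L) 3 ((StdForm.antidiagonal 3).over L))]
  [MeasurableSpace (AdeleRing (𝓞 L) L)ˣ] [BorelSpace (AdeleRing (𝓞 L) L)ˣ]  -- ED. 11: the idele frame of ★ `hMSP'_midWitness_of_coordLetters`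


/-! ## The edition -/

/-- **(V) OF RECORD, ED. 17 — `LHalfNeZero (ξ.bcη⁻¹·μω) → resGMidBlock L μ ξ μω ≠ ⊥` AT THE PRINCIPAL CONGRUENCE LEVEL `K(𝔫)`, THE `c_S` CURRENCY RE-KEYED (M2)**: ED. 16's content —
★ p864046 `resGMidBlock_ne_bot_of_ledger_letters` fed BY NAME exactly as in ED. 13–16 (pole ledger ★ `ledgerLetters_of_exports` on `hE6` ★, `hMSP′` ★ `…_of_unfolding`, `hMS32` ★ p865104; `hreal` ★ p864973,
`hρ₁ hφ1 hχ₁` ★ NeBotAssembly §1; basis `bV` ★ p865115; row (ii) ★ ED. 12 §1; Euler factorisation ★ p864823; row (i′) ★ `hE6_midWitness` twisted by `detChar ξ.ψ`; `A` named, `hA` ★, `hA32` ★) —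
with the ramification frame `(S, T′) := ({w ∣ w.under 𝓞_{L⁺} ∈ S₀}, S₀)` (finite by ★ `finite_placesOver`; `χ` unramified off `S` by the NEW binder `hur`; `η = 1` unramified everywhere), so that
the partial `L`-ratio in `hunfK` and `hsrc` is the one ★ p864886 `hunfK_of_core` ∕ ★ p864821 produce.  [cite: Rogawski1990, §13.9 (ii) p. 229] [cite: MoeglinWaldspurger1995, II.1.7, IV.1.11, IV.2.3, IV.3.12]
[cite: TateThesis1967, Lemma 3.2.1] [cite: BernsteinLapid2019, Thm 2.3, §4] -/
theorem resGMidBlock_ne_bot_of_record_v17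
    (μ : Measure (quasiSplit (↥(maximalRealSubfield L)) L (IsCMField.complexConj L) 3).automorphicQuotient) [(quasiSplit (↥(maximalRealSubfield L)) L (IsCMField.complexConj L) 3).IsAutomorphicMeasure μ]
    (μω : HeckeCharacter L) (hμu : μω.IsUnitary)
    (hμω : ∀ x : ideleGroup ↥(maximalRealSubfield L), μω (AdeleRing.ideleBaseChange (↥(maximalRealSubfield L)) L x) = quadraticHeckeCharCM L x)
    (ξ : OneDimAutRepH L)
    -- the exports' structural data (Haar measures, fundamental domain, covering weight, CM frame facts)
    (νG : Measure (quasiSplit (↥(maximalRealSubfield L)) L (IsCMField.complexConj L) 3).Adelic) [νG.IsHaarMeasure] [νG.IsInvInvariant] [SFinite νG]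
    (ν : Measure ↥(adelicUnipotent (↥(maximalRealSubfield L)) L (IsCMField.complexConj L) 3)) [ν.IsHaarMeasure] [ν.IsMulRightInvariant] [ν.IsInvInvariant]
    {𝓕 : Set ↥(adelicUnipotent (↥(maximalRealSubfield L)) L (IsCMField.complexConj L) 3)}
    (h𝓕N : IsFundamentalDomain ↥(rationalUnipotent (↥(maximalRealSubfield L)) L (IsCMField.complexConj L) 3) 𝓕 ν) (h𝓕c : IsCompact (closure 𝓕)) (h𝓕₀ : ν 𝓕 ≠ 0)
    {β : (quasiSplit (↥(maximalRealSubfield L)) L (IsCMField.complexConj L) 3).Adelic → ℝ≥0∞}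
    (hβ : IsCoveringWeight ↥((arithmeticBorel (↥(maximalRealSubfield L)) L (IsCMField.complexConj L) 3).map (quasiSplit (↥(maximalRealSubfield L)) L (IsCMField.complexConj L) 3).arithmeticSubgroup.subtype) β)
    {μZ : Measure (borelQuotient (↥(maximalRealSubfield L)) L (IsCMField.complexConj L) 3)} [SFinite μZ]
    (hμZ : ∀ f : borelQuotient (↥(maximalRealSubfield L)) L (IsCMField.complexConj L) 3 → ℝ≥0∞, Measurable f → ∫⁻ z, f z ∂μZ = ∫⁻ g, β g * f (toBorelQuotient (↥(maximalRealSubfield L)) L (IsCMField.complexConj L) 3 g) ∂νG)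
    (μa : Measure (arch (↥(maximalRealSubfield L)) L (IsCMField.complexConj L) 3 ((StdForm.antidiagonal 3).over L))) [μa.IsHaarMeasure] [μa.IsMulRightInvariant]
    (μf : Measure (finAdelic (↥(maximalRealSubfield L)) L (IsCMField.complexConj L) 3 ((StdForm.antidiagonal 3).over L))) [μf.IsHaarMeasure]
    (h2 : Module.finrank (↥(maximalRealSubfield L)) L = 2) (hc : IsCMField.complexConj L ≠ 1)
    -- (i) THE LEVEL OF RECORD `K(𝔫)` BY NAME, `𝔫 ≠ 0` (K2E1-p11 ★ p863976 ∕ p864091 ∕ p864141; `K_f := finCongruenceLevel 𝔫`, `U₀ := K_f(𝔫) ≤ GL₃(𝔸_f)` open compact ★ Ash–Smith): `K′ := levelOfRecord K(𝔫)_f`, `ω₀ := omegaOfRecord χ 1 K(𝔫)_f`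
    (𝔫 : Ideal (𝓞 L)) (h𝔫 : 𝔫 ≠ 0)
    -- (i) THE WITNESS AS BINDERS (J-S8-WIT′): `φ₀ ∈ V(ξ.bcη⁻¹·μω; levelOfRecord K_f, omegaOfRecord … 1 K_f)`, continuous, `‖φ₀‖ ≤ 1` (`Mφ := 1`)
    {φ₀ : (quasiSplit (↥(maximalRealSubfield L)) L (IsCMField.complexConj L) 3).Adelic → ℂ} (hφ₀V : φ₀ ∈ chiSectionSpace (ξ.bcη⁻¹ * μω) (levelOfRecord L (finCongruenceLevel (↥(maximalRealSubfield L)) L (IsCMField.complexConj L) 3 ((StdForm.antidiagonal 3).over L) 𝔫)) (omegaOfRecord L (ξ.bcη⁻¹ * μω) (1 : ↥(TorusDict.torus (IsCMField.complexConj L)) →ₜ* ℂˣ) (finCongruenceLevel (↥(maximalRealSubfield L)) L (IsCMField.complexConj L) 3 ((StdForm.antidiagonal 3).over L) 𝔫))) (hφ₀c : Continuous φ₀) (hφ₀M : ∀ x, ‖φ₀ x‖ ≤ 1)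
    -- (i) VISIBLE: TWO LETTERS about the NAMED UNTWISTED family `midWitnessEc` off the NAMED `midWitnessP` ((E6) `hE6` is ★ `hE6_midWitness` since ED. 10; ★ `ledgerLetters_of_exports` turns the three into ★ p864046's `hbddPK hbdd32` for `midWitnessEc·Θ`)
    -- (i) ED. 14–16: `hMSP′` ★, `hMS32` ★, the basis `bV` ★ p865115 (chosen inside the proof) — only the Maass–Selberg frame extras stay visible (`hqa` PAID by ★ p864823 from `hunfK` below)
    (μK : Measure ((standardMaximalCompactGL 3 L).comap (adelicVal (↥(maximalRealSubfield L)) L (IsCMField.complexConj L) 3 ((StdForm.antidiagonal 3).over L)) : Subgroup (quasiSplit (↥(maximalRealSubfield L)) L (IsCMField.complexConj L) 3).Adelic)) [μK.IsHaarMeasure]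
    (νI : Measure (AdeleRing (𝓞 L) L)ˣ) [νI.IsHaarMeasure]
    {𝓕I : Set (AdeleRing (𝓞 L) L)ˣ} (h𝓕I : IsIdeleClassDomain L 𝓕I) (h𝓕1 : ν 𝓕 = 1)
    -- (iii) ED. 17 (M2): THE RE-KEYED RAMIFICATION CURRENCY — a finite set `S₀` of finite places of `L⁺` (also the index set of `A`'s finite part) above which `χ = ξ.bcη⁻¹·μω` is unramified (`hur` = ★ (a-2b)'s `hgood`, second half;
    -- payer ★ `hgood_unfoldingBadPlaces … |>.2` at `S₀ := unfoldingBadPlaces`); `c_S` below is read at `(S, T′) := ({w ∣ w.under ∈ S₀}, S₀)` — the currency of ★ p864886 `hunfK_of_core` and ★ p864821 `hsrc_of_record_at_basePoint_of_core`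
    (S₀ : Finset (HeightOneSpectrum (𝓞 ↥(maximalRealSubfield L)))) (hur : ∀ v ∉ S₀, ∀ w : PlacesOver L v, (ξ.bcη⁻¹ * μω).IsUnramifiedAt w.1)
    -- (ii) ED. 12∕13: ROW (ii) IS BOUND (§1 `rowTwo_of_coordRoad`) and the Euler factorisation is ★ p864823; visible: the BASE POINT `g₁`, `φ ≠ 1`, and THE ONE UNFOLDING LETTER `hunfK` (K2E2-p12 (g10)'s bytes)
    (g₁ : (quasiSplit (↥(maximalRealSubfield L)) L (IsCMField.complexConj L) 3).Adelic)
    (hunfK : ∀ k : (quasiSplit (↥(maximalRealSubfield L)) L (IsCMField.complexConj L) 3).Adelic, adelicVal (↥(maximalRealSubfield L)) L (IsCMField.complexConj L) 3 ((StdForm.antidiagonal 3).over L) k ∈ standardMaximalCompactGL 3 L →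
      ∃ A : ℂ → ℂ, DifferentiableOn ℂ A {z : ℂ | 1 < z.re} ∧ ∀ z : ℂ, 2 < z.re →
        (∫ v : ↥(adelicUnipotent (↥(maximalRealSubfield L)) L (IsCMField.complexConj L) 3), flatSectionU φ₀ z (((quasiSplit (↥(maximalRealSubfield L)) L (IsCMField.complexConj L) 3).toAdelic (weylLongU ((IsCMField.complexConj L : L ≃ₐ[↥(maximalRealSubfield L)] L) : L →+* L) (rfl : (StdForm.antidiagonal 3).over L = (StdForm.antidiagonal 3).over L))) * ((v : (quasiSplit (↥(maximalRealSubfield L)) L (IsCMField.complexConj L) 3).Adelic) * k)) ∂ν) =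
          ((partialStandardL {w : HeightOneSpectrum (𝓞 L) | w.under (𝓞 ↥(maximalRealSubfield L)) ∈ (↑S₀ : Set (HeightOneSpectrum (𝓞 ↥(maximalRealSubfield L))))} (fun w => {(ξ.bcη⁻¹ * μω).valueAtUniformizer w}) (z - 1) * partialStandardL (↑S₀ : Set (HeightOneSpectrum (𝓞 ↥(maximalRealSubfield L)))) (fun v => {(1 : HeckeCharacter ↥(maximalRealSubfield L)).valueAtUniformizer v}) (2 * z - 2)) /
            (partialStandardL {w : HeightOneSpectrum (𝓞 L) | w.under (𝓞 ↥(maximalRealSubfield L)) ∈ (↑S₀ : Set (HeightOneSpectrum (𝓞 ↥(maximalRealSubfield L))))} (fun w => {(ξ.bcη⁻¹ * μω).valueAtUniformizer w}) z * partialStandardL (↑S₀ : Set (HeightOneSpectrum (𝓞 ↥(maximalRealSubfield L)))) (fun v => {(1 : HeckeCharacter ↥(maximalRealSubfield L)).valueAtUniformizer v}) (2 * z - 1))) * A z)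
    -- (iii) ★ p864046's row (iii): the ramification data is BOUND BY NAME — ED. 17: `S := {w ∣ w.under ∈ S₀}`, `T′ := S₀` (ED. 9–16: `ramifiedPlaces`, `∅`); the NAMED `A` (below)
    -- (iii) `A` FULLY NAMED AT THE MID-BLOCK TABLE `m_w = kμ,w − 2·ξ.eη w` (★ p864366 + K2E1-p13's ★ `shiftExponents_spec`; visible: the parity `hk` of `kμ`): `A z := (C·∏_{v∈S₀} ν_v(𝒪_v³)⁻¹ • ∫ 𝟙_{B_v(𝔫)}·Q_v^{−z}) · ∫∫ (∏_w ε_w·archUnitaryValue m_w 0 ζ_w·((2+ζ_w)∕ζ_w)^{p_w}·((2+conj ζ_w)∕conj ζ_w)^{q_w})·ARCH₃^{−z}`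
    {δ : L} (hcδ : IsCMField.complexConj L δ = -δ) (hδ : δ ≠ 0) {d : ↥(maximalRealSubfield L)} (hd : δ * δ = algebraMap ↥(maximalRealSubfield L) L d)
    [∀ v : HeightOneSpectrum (𝓞 ↥(maximalRealSubfield L)), MeasurableSpace (v.adicCompletion ↥(maximalRealSubfield L))] [∀ v : HeightOneSpectrum (𝓞 ↥(maximalRealSubfield L)), BorelSpace (v.adicCompletion ↥(maximalRealSubfield L))]
    (νv : ∀ v : HeightOneSpectrum (𝓞 ↥(maximalRealSubfield L)), Measure (v.adicCompletion ↥(maximalRealSubfield L))) [∀ v, (νv v).IsAddHaarMeasure]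
    [MeasurableSpace (InfiniteAdeleRing L)] [BorelSpace (InfiniteAdeleRing L)]
    [MeasurableSpace (InfiniteAdeleRing ↥(maximalRealSubfield L))] [BorelSpace (InfiniteAdeleRing ↥(maximalRealSubfield L))]
    (μE₁ : Measure (InfiniteAdeleRing L)) [μE₁.IsAddHaarMeasure] (μF₁ : Measure (InfiniteAdeleRing ↥(maximalRealSubfield L))) [μF₁.IsAddHaarMeasure]
    (ε : InfinitePlace L → ℂ) (hε1 : ∀ w, ‖ε w‖ ≤ 1) (hε0 : ∀ w, ε w ≠ 0)
    (kμ : InfinitePlace L → ℤ) (hk : ∀ w, Int.ModEq 2 (kμ w) 1)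
    {C : ℂ} (hC : C ≠ 0)
    -- (`hA` — holomorphy of the named `A` on `{1 < Re}` — is ★ `differentiableOn_amplitude_shifted_midBlock`, bound by name in the proof; it costs the binders `{d} (hd)`: `δ² ∈ L⁺`)
    (hsrc : ∀ z : ℂ, 2 < z.re → (∫ v : ↥(adelicUnipotent (↥(maximalRealSubfield L)) L (IsCMField.complexConj L) 3), flatSectionU φ₀ z ((quasiSplit (↥(maximalRealSubfield L)) L (IsCMField.complexConj L) 3).toAdelic (weylLongU ((IsCMField.complexConj L : L ≃ₐ[↥(maximalRealSubfield L)] L) : L →+* L) (rfl : (StdForm.antidiagonal 3).over L = (StdForm.antidiagonal 3).over L)) * ((v : (quasiSplit (↥(maximalRealSubfield L)) L (IsCMField.complexConj L) 3).Adelic) * g₁)) ∂ν) * (((borelHeight g₁ : ℝ) : ℂ) ^ (z - 2)) *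
        (((detChar (↥(maximalRealSubfield L)) L (IsCMField.complexConj L) h2 hc 3 ((StdForm.antidiagonal 3).over L) ξ.ψ ξ.hψ (antidiagonal_over_det_ne_zero L 3)) g₁ : ℂˣ) : ℂ) = (fun z : ℂ => (C * ∏ v ∈ S₀, ((Measure.pi fun _ : Fin 3 => νv v) (integralBox ↥(maximalRealSubfield L) (Fin 3) v)).toReal⁻¹ •
              ∫ p : Fin 3 → v.adicCompletion ↥(maximalRealSubfield L),
                Set.indicator {p : Fin 3 → v.adicCompletion ↥(maximalRealSubfield L) | p ∈ integralBox ↥(maximalRealSubfield L) (Fin 3) v ∧ ∀ w' : PlacesOver L v,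
                    Valued.v (quadraticLocalEquiv L v (IsCMField.complexConj L) hcδ hδ (p 0, p 1) w') ≤ idealRadius L w'.1 𝔫 ∧
                    Valued.v (conjLocal L (IsCMField.complexConj L) v (quadraticLocalEquiv L v (IsCMField.complexConj L) hcδ hδ (p 0, p 1)) w') ≤ idealRadius L w'.1 𝔫 ∧
                    Valued.v ((toLocalRing L v (p 2) * algebraMap L (LocalRing L v) δ -
                      toLocalRing L v 2⁻¹ * (quadraticLocalEquiv L v (IsCMField.complexConj L) hcδ hδ (p 0, p 1) * conjLocal L (IsCMField.complexConj L) v (quadraticLocalEquiv L v (IsCMField.complexConj L) hcδ hδ (p 0, p 1)))) w') ≤ idealRadius L w'.1 𝔫}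
                  (fun _ => (1 : ℂ)) p *
                (((∏ w' : PlacesOver L v, max 1 (max ((normAbs (w'.1.adicCompletion L) (quadraticLocalEquiv L v (IsCMField.complexConj L) hcδ hδ (p 0, p 1) w') : ℝ≥0) : ℝ)
                  ((normAbs (w'.1.adicCompletion L) ((toLocalRing L v (p 2) * algebraMap L (LocalRing L v) δ -
                    toLocalRing L v 2⁻¹ * (quadraticLocalEquiv L v (IsCMField.complexConj L) hcδ hδ (p 0, p 1) *
                      conjLocal L (IsCMField.complexConj L) v (quadraticLocalEquiv L v (IsCMField.complexConj L) hcδ hδ (p 0, p 1)))) w') : ℝ≥0) : ℝ))) : ℝ) : ℂ) ^ (-z) ∂(Measure.pi fun _ : Fin 3 => νv v)) *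
            ∫ Xi : InfiniteAdeleRing L, ∫ a : InfiniteAdeleRing ↥(maximalRealSubfield L),
            (∏ w : InfinitePlace L, ε w * archUnitaryValue (kμ w - 2 * ξ.eη w) 0 ((((-(1 + ‖Xi w‖ ^ 2 / 2)) : ℝ) : ℂ) + (((w.embedding δ).im * ((InfiniteAdeleRing.ringEquiv_mixedSpace ↥(maximalRealSubfield L)) a).1 ⟨w.comap (algebraMap ↥(maximalRealSubfield L) L), Summit.HodgeConjecture.HodgeConjecture.Cruxes.H413.K2E1HeightBigCellLineFormulaU2.isReal_comap_maximalRealSubfield L w⟩ : ℝ) : ℂ) * Complex.I) * (((2 : ℂ) + ((((-(1 + ‖Xi w‖ ^ 2 / 2)) : ℝ) : ℂ) + (((w.embedding δ).im * ((InfiniteAdeleRing.ringEquiv_mixedSpace ↥(maximalRealSubfield L)) a).1 ⟨w.comap (algebraMap ↥(maximalRealSubfield L) L), Summit.HodgeConjecture.HodgeConjecture.Cruxes.H413.K2E1HeightBigCellLineFormulaU2.isReal_comap_maximalRealSubfield L w⟩ : ℝ) : ℂ) * Complex.I)) / ((((-(1 + ‖Xi w‖ ^ 2 / 2)) : ℝ)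 : ℂ) + (((w.embedding δ).im * ((InfiniteAdeleRing.ringEquiv_mixedSpace ↥(maximalRealSubfield L)) a).1 ⟨w.comap (algebraMap ↥(maximalRealSubfield L) L), Summit.HodgeConjecture.HodgeConjecture.Cruxes.H413.K2E1HeightBigCellLineFormulaU2.isReal_comap_maximalRealSubfield L w⟩ : ℝ) : ℂ) * Complex.I)) ^ (((kμ w - 2 * ξ.eη w) - 1) / 2).toNat * (((2 : ℂ) + conj ((((-(1 + ‖Xi w‖ ^ 2 / 2)) : ℝ) : ℂ) + (((w.embedding δ).im * ((InfiniteAdeleRing.ringEquiv_mixedSpace ↥(maximalRealSubfield L)) a).1 ⟨w.comap (algebraMap ↥(maximalRealSubfield L) L), Summit.HodgeConjecture.HodgeConjecture.Cruxes.H413.K2E1HeightBigCellLineFormulaU2.isReal_comap_maximalRealSubfield L w⟩ : ℝ) : ℂ) * Complex.I)) / conj ((((-(1 + ‖Xi w‖ ^ 2 / 2)) : ℝ) : ℂ) + (((w.embedding δ).im * ((InfiniteAdeleRing.ringEquiv_mixedSpace ↥(maximalRealSubfield L)) a).1 ⟨w.comap (algebraMap ↥(maximalRealSubfield L) L), Summit.HodgeConjecture.HodgeConjecture.Cruxes.H413.K2E1HeightBigCellLineFormulaU2.isReal_comap_maximalRealSubfield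 L w⟩ : ℝ) : ℂ) * Complex.I)) ^ ((-(kμ w - 2 * ξ.eη w) - 1) / 2).toNat) *
              ((((∏ w : InfinitePlace L, ((1 + ‖(Xi) w‖ ^ 2 / 2) ^ 2 + (w δ) ^ 2 * (((InfiniteAdeleRing.ringEquiv_mixedSpace ↥(maximalRealSubfield L)) a).1 ⟨w.comap (algebraMap ↥(maximalRealSubfield L) L), Summit.HodgeConjecture.HodgeConjecture.Cruxes.H413.K2E1HeightBigCellLineFormulaU2.isReal_comap_maximalRealSubfield L w⟩) ^ 2))) : ℝ) : ℂ) ^ (-z) ∂μF₁ ∂μE₁) z *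
          ((partialStandardL {w : HeightOneSpectrum (𝓞 L) | w.under (𝓞 ↥(maximalRealSubfield L)) ∈ (↑S₀ : Set (HeightOneSpectrum (𝓞 ↥(maximalRealSubfield L))))} (fun w => {(ξ.bcη⁻¹ * μω).valueAtUniformizer w}) (z - 1) * partialStandardL (↑S₀ : Set (HeightOneSpectrum (𝓞 ↥(maximalRealSubfield L)))) (fun v => {(1 : HeckeCharacter ↥(maximalRealSubfield L)).valueAtUniformizer v}) (2 * z - 2)) /
            (partialStandardL {w : HeightOneSpectrum (𝓞 L) | w.under (𝓞 ↥(maximalRealSubfield L)) ∈ (↑S₀ : Set (HeightOneSpectrum (𝓞 ↥(maximalRealSubfield L))))} (fun w => {(ξ.bcη⁻¹ * μω).valueAtUniformizer w}) z * partialStandardL (↑S₀ : Set (HeightOneSpectrum (𝓞 ↥(maximalRealSubfield L)))) (fun v => {(1 : HeckeCharacter ↥(maximalRealSubfield L)).valueAtUniformizer v}) (2 * z - 1)))) :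
    LHalfNeZero (ξ.bcη⁻¹ * μω) → resGMidBlock L μ ξ μω ≠ ⊥ := by
  -- ED. 16: the continuous bounded basis of the reflected level-of-record block (★ p865115), chosen here
  obtain ⟨ι', hι, hdec, bV, Mb, hbc, hbM⟩ := exists_blockBasis_levelOfRecord L (ξ.bcη⁻¹ * μω) (isUnitary_bcηInv_mul L ξ hμu) h𝔫
  -- ED. 17 (M2): the re-keyed ramification frame — `S := {w ∣ w.under 𝓞_{L⁺} ∈ S₀}` is finite (finitely many places over each `v`, ★ `finite_placesOver`) and `χ` is unramified off `S` (`hur`)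
  have hS : ({w : HeightOneSpectrum (𝓞 L) | w.under (𝓞 ↥(maximalRealSubfield L)) ∈ (↑S₀ : Set (HeightOneSpectrum (𝓞 ↥(maximalRealSubfield L))))} : Set (HeightOneSpectrum (𝓞 L))).Finite := by
    have h : ({w : HeightOneSpectrum (𝓞 L) | w.under (𝓞 ↥(maximalRealSubfield L)) ∈ (↑S₀ : Set (HeightOneSpectrum (𝓞 ↥(maximalRealSubfield L))))} : Set (HeightOneSpectrum (𝓞 L))) =
        ⋃ v ∈ (↑S₀ : Set (HeightOneSpectrum (𝓞 ↥(maximalRealSubfield L)))), {w : HeightOneSpectrum (𝓞 L) | w.under (𝓞 ↥(maximalRealSubfield L)) = v} := by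
      ext w
      simp
    rw [h]
    exact Set.Finite.biUnion S₀.finite_toSet fun v _ => Set.finite_coe_iff.mp (finite_placesOver (F := ↥(maximalRealSubfield L)) (E := L) v)
  have hurφ : ∀ w ∉ ({w : HeightOneSpectrum (𝓞 L) | w.under (𝓞 ↥(maximalRealSubfield L)) ∈ (↑S₀ : Set (HeightOneSpectrum (𝓞 ↥(maximalRealSubfield L))))} : Set (HeightOneSpectrum (𝓞 L))), (ξ.bcη⁻¹ * μω).IsUnramifiedAt w :=
    fun w hw => hur (w.under (𝓞 ↥(maximalRealSubfield L))) hw ⟨w, rfl⟩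
  -- ED. 14: `χ` unitary, trivial on the positive real ideles, `≠ 1` (★ NeBotAssembly §1) and the axis-reality letter ★ p864973 `hreal_midWitness` (letter-free)
  have hχ₁ : (ξ.bcη⁻¹ * μω).IsUnitary := isUnitary_bcηInv_mul L ξ hμu
  have hρ₁ := bcηInv_mul_posRealIdele L ξ μω hμω
  have hφ1 := bcηInv_mul_ne_one L ξ μω hμω
  have hreal := hreal_midWitness L μ νG ν h𝓕N h𝓕c h𝓕₀ hβ hμZ hφ₀V hφ₀c hφ₀M (levelOfRecord_le L (finCongruenceLevel (↥(maximalRealSubfield L)) L (IsCMField.complexConj L) 3 ((StdForm.antidiagonal 3).over L) 𝔫)) (archToAdelic_mem_levelOfRecord L (finCongruenceLevel (↥(maximalRealSubfield L)) L (IsCMField.complexConj L) 3 ((StdForm.antidiagonal 3).over L) 𝔫)) ((principalCongruenceLevel 3 L 𝔫).comap (GLn.ofFinite 3 L)) (isOpen_comap_ofFinite_principalCongruenceLevel 3 L h𝔫) (isCompact_comap_ofFinite_principalCongruenceLevel 3 L h𝔫) (fun _ hb => exists_mem_levelOfRecord_omegaOfRecord_eq_one L (ξ.bcη⁻¹ *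 μω) (1 : ↥(TorusDict.torus (IsCMField.complexConj L)) →ₜ* ℂˣ) (finCongruenceLevel_le_integralLevel (↥(maximalRealSubfield L)) L (IsCMField.complexConj L) 3 ((StdForm.antidiagonal 3).over L) 𝔫) hb) (fun _ hφ => continuous_of_mem_chiSectionSpace_levelOfRecord L (ξ.bcη⁻¹ * μω) (finCongruenceLevel_le_integralLevel (↥(maximalRealSubfield L)) L (IsCMField.complexConj L) 3 ((StdForm.antidiagonal 3).over L) 𝔫) (isOpen_finCongruenceLevel (↥(maximalRealSubfield L)) L (IsCMField.complexConj L) 3 ((StdForm.antidiagonal 3).over L) h𝔫) hφ) μa μf bV hbc hbM h2 hc (antidiagonal_over_det_ne_zero L 3) ξ.ψ ξ.hψ μK νI h𝓕I h𝓕1 hχ₁ hρ₁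
  -- ED. 15: the (MS-3∕2) letter ★ p865104 `hMS32_midWitness_of_unfolding` of `hunfK` alone, AT THE RE-KEYED FRAME
  have hMS32 := hMS32_midWitness_of_unfolding L μ νG ν h𝓕N h𝓕c h𝓕₀ hβ hμZ hφ₀V hφ₀c hφ₀M (levelOfRecord_le L (finCongruenceLevel (↥(maximalRealSubfield L)) L (IsCMField.complexConj L) 3 ((StdForm.antidiagonal 3).over L) 𝔫)) (archToAdelic_mem_levelOfRecord L (finCongruenceLevel (↥(maximalRealSubfield L)) L (IsCMField.complexConj L) 3 ((StdForm.antidiagonal 3).over L) 𝔫)) ((principalCongruenceLevel 3 L 𝔫).comap (GLn.ofFinite 3 L)) (isOpen_comap_ofFinite_principalCongruenceLevel 3 L h𝔫) (isCompact_comap_ofFinite_principalCongruenceLevel 3 L h𝔫) (fun _ hb => exists_mem_levelOfRecord_omegaOfRecord_eq_one L (ξ.bcη⁻¹ * μω) (1 : ↥(TorusDict.torus (IsCMField.complexConj L)) →ₜ* ℂˣ) (finCongruenceLevel_le_integralLevel (↥(maximalRealSubfield L)) L (IsCMField.complexConj L) 3 ((StdForm.antidiagonal 3).over L) 𝔫)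 hb) (fun _ hφ => continuous_of_mem_chiSectionSpace_levelOfRecord L (ξ.bcη⁻¹ * μω) (finCongruenceLevel_le_integralLevel (↥(maximalRealSubfield L)) L (IsCMField.complexConj L) 3 ((StdForm.antidiagonal 3).over L) 𝔫) (isOpen_finCongruenceLevel (↥(maximalRealSubfield L)) L (IsCMField.complexConj L) 3 ((StdForm.antidiagonal 3).over L) h𝔫) hφ) μa μf bV hbc hbM h2 hc (antidiagonal_over_det_ne_zero L 3) ξ.ψ ξ.hψ h𝓕1 μK νI h𝓕I hχ₁ hρ₁ hχ₁ hρ₁ hS hurφ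
    HeckeCharacter.isUnitary_one (fun _ => rfl) S₀.finite_toSet (fun _ _ _ => rfl) hunfK
  -- ========== ED. 13's body (★ p864963 :196–:285) VERBATIM at the re-keyed frame ==========
  -- closedness and co-discreteness of the NAMED candidate pole set (★ `midWitnessExports_spec`, clauses 7, 8) at the level of record `K(𝔫)`
  obtain ⟨-, hqφ, -, -, hE2, hqcq, hPc, hPcd', -, -, hqcan, -, -, -, -, -, -, -, -, -, hEΘdiff, hEΘ4, hEΘbd⟩ := midWitnessExports_spec L μ νG ν h𝓕N h𝓕c h𝓕₀ hβ hμZ hφ₀V hφ₀c hφ₀M (levelOfRecord_le L (finCongruenceLevel (↥(maximalRealSubfield L)) L (IsCMField.complexConj L) 3 ((StdForm.antidiagonal 3).over L) 𝔫)) (archToAdelic_mem_levelOfRecord L (finCongruenceLevel (↥(maximalRealSubfield L)) L (IsCMField.complexConj L) 3 ((StdForm.antidiagonal 3).over L) 𝔫)) ((principalCongruenceLevel 3 L 𝔫).comap (GLn.ofFinite 3 L)) (isOpen_comap_ofFinite_principalCongruenceLevel 3 L h𝔫) (isCompact_comap_ofFinite_principalCongruenceLevel 3 L h𝔫) (fun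 _ hb => exists_mem_levelOfRecord_omegaOfRecord_eq_one L (ξ.bcη⁻¹ * μω) (1 : ↥(TorusDict.torus (IsCMField.complexConj L)) →ₜ* ℂˣ) (finCongruenceLevel_le_integralLevel (↥(maximalRealSubfield L)) L (IsCMField.complexConj L) 3 ((StdForm.antidiagonal 3).over L) 𝔫) hb) (fun _ hφ => continuous_of_mem_chiSectionSpace_levelOfRecord L (ξ.bcη⁻¹ * μω) (finCongruenceLevel_le_integralLevel (↥(maximalRealSubfield L)) L (IsCMField.complexConj L) 3 ((StdForm.antidiagonal 3).over L) 𝔫) (isOpen_finCongruenceLevel (↥(maximalRealSubfield L)) L (IsCMField.complexConj L) 3 ((StdForm.antidiagonal 3).over L) h𝔫) hφ) μa μf bV hbc hbM h2 hc (antidiagonal_over_det_ne_zero L 3) ξ.ψ ξ.hψ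
  -- the row-(ii) domain `D := ({1 < Re} ∖ {3∕2}) ∖ P` BY NAME: open, eventually near `3∕2` along the punctured filter, inside the slit half-plane
  have hDo : IsOpen (({z : ℂ | 1 < z.re} \ (↑({(3 : ℂ) / 2} : Finset ℂ) : Set ℂ)) ∩ (midWitnessP L μ νG ν h𝓕N h𝓕c h𝓕₀ hβ hμZ hφ₀V hφ₀c hφ₀M (levelOfRecord_le L (finCongruenceLevel (↥(maximalRealSubfield L)) L (IsCMField.complexConj L) 3 ((StdForm.antidiagonal 3).over L) 𝔫)) (archToAdelic_mem_levelOfRecord L (finCongruenceLevel (↥(maximalRealSubfield L)) L (IsCMField.complexConj L) 3 ((StdForm.antidiagonal 3).over L) 𝔫)) ((principalCongruenceLevel 3 L 𝔫).comap (GLn.ofFinite 3 L)) (isOpen_comap_ofFinite_principalCongruenceLevel 3 L h𝔫) (isCompact_comap_ofFinite_principalCongruenceLevel 3 L h𝔫) (fun _ hb => exists_mem_levelOfRecord_omegaOfRecord_eq_one L (ξ.bcη⁻¹ * μω) (1 : ↥(TorusDict.torus (IsCMField.complexConj L)) →ₜ* ℂˣ) (finCongruenceLevel_le_integralLevel (↥(maximalRealSubfield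 L)) L (IsCMField.complexConj L) 3 ((StdForm.antidiagonal 3).over L) 𝔫) hb) (fun _ hφ => continuous_of_mem_chiSectionSpace_levelOfRecord L (ξ.bcη⁻¹ * μω) (finCongruenceLevel_le_integralLevel (↥(maximalRealSubfield L)) L (IsCMField.complexConj L) 3 ((StdForm.antidiagonal 3).over L) 𝔫) (isOpen_finCongruenceLevel (↥(maximalRealSubfield L)) L (IsCMField.complexConj L) 3 ((StdForm.antidiagonal 3).over L) h𝔫) hφ) μa μf bV hbc hbM h2 hc (antidiagonal_over_det_ne_zero L 3) ξ.ψ ξ.hψ)ᶜ) :=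
    ((isOpen_lt continuous_const Complex.continuous_re).sdiff (Finset.finite_toSet _).isClosed).inter hPc.isOpen_compl
  have hre : ∀ᶠ z in 𝓝[≠] ((3 : ℂ) / 2), 1 < z.re :=
    eventually_nhdsWithin_of_eventually_nhds ((isOpen_lt continuous_const Complex.continuous_re).mem_nhds (by norm_num : (1 : ℝ) < ((3 : ℂ) / 2).re))
  have hD : ∀ᶠ z in 𝓝[≠] ((3 : ℂ) / 2), z ∈ (({z : ℂ | 1 < z.re} \ (↑({(3 : ℂ) / 2} : Finset ℂ) : Set ℂ)) ∩ (midWitnessP L μ νG ν h𝓕N h𝓕c h𝓕₀ hβ hμZ hφ₀V hφ₀c hφ₀M (levelOfRecord_le L (finCongruenceLevel (↥(maximalRealSubfield L)) L (IsCMField.complexConj L) 3 ((StdForm.antidiagonal 3).over L) 𝔫)) (archToAdelic_mem_levelOfRecord L (finCongruenceLevel (↥(maximalRealSubfield L)) L (IsCMField.complexConj L) 3 ((StdForm.antidiagonal 3).over L) 𝔫)) ((principalCongruenceLevel 3 L 𝔫).comap (GLn.ofFinite 3 L)) (isOpen_comap_ofFinite_principalCongruenceLevel 3 L h𝔫) (isCompact_comap_ofFinite_principalCongruenceLevel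 3 L h𝔫) (fun _ hb => exists_mem_levelOfRecord_omegaOfRecord_eq_one L (ξ.bcη⁻¹ * μω) (1 : ↥(TorusDict.torus (IsCMField.complexConj L)) →ₜ* ℂˣ) (finCongruenceLevel_le_integralLevel (↥(maximalRealSubfield L)) L (IsCMField.complexConj L) 3 ((StdForm.antidiagonal 3).over L) 𝔫) hb) (fun _ hφ => continuous_of_mem_chiSectionSpace_levelOfRecord L (ξ.bcη⁻¹ * μω) (finCongruenceLevel_le_integralLevel (↥(maximalRealSubfield L)) L (IsCMField.complexConj L) 3 ((StdForm.antidiagonal 3).over L) 𝔫) (isOpen_finCongruenceLevel (↥(maximalRealSubfield L)) L (IsCMField.complexConj L) 3 ((StdForm.antidiagonal 3).over L) h𝔫) hφ) μa μf bV hbc hbM h2 hc (antidiagonal_over_det_ne_zero L 3) ξ.ψ ξ.hψ)ᶜ) := by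
    filter_upwards [hre, hPcd' ((3 : ℂ) / 2), self_mem_nhdsWithin] with z hz hzP hne
    refine ⟨⟨hz, ?_⟩, hzP⟩
    rw [Finset.coe_singleton, Set.mem_singleton_iff]
    exact hne
  -- ★ `ledgerLetters_of_exports` (S8-R210 (2)): the pole ledger's two letters for `midWitnessEc·Θ` from the three untwisted letters, at the level of record
  -- (`hχ₁ hρ₁ hφ1 hreal hMS32` are bound above — ED. 14∕15 — instead of being binders)
  obtain ⟨hbddPK, hbdd32⟩ := ledgerLetters_of_exports L μ νG ν h𝓕N h𝓕c h𝓕₀ hβ hμZ hφ₀V hφ₀c hφ₀M (levelOfRecord_le L (finCongruenceLevel (↥(maximalRealSubfield L)) L (IsCMField.complexConj L) 3 ((StdForm.antidiagonal 3).over L) 𝔫)) (archToAdelic_mem_levelOfRecord L (finCongruenceLevel (↥(maximalRealSubfield L)) L (IsCMField.complexConj L) 3 ((StdForm.antidiagonal 3).over L) 𝔫)) ((principalCongruenceLevel 3 L 𝔫).comap (GLn.ofFinite 3 L)) (isOpen_comap_ofFinite_principalCongruenceLevel 3 L h𝔫) (isCompact_comap_ofFinite_principalCongruenceLevel 3 L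 h𝔫) (fun _ hb => exists_mem_levelOfRecord_omegaOfRecord_eq_one L (ξ.bcη⁻¹ * μω) (1 : ↥(TorusDict.torus (IsCMField.complexConj L)) →ₜ* ℂˣ) (finCongruenceLevel_le_integralLevel (↥(maximalRealSubfield L)) L (IsCMField.complexConj L) 3 ((StdForm.antidiagonal 3).over L) 𝔫) hb) (fun _ hφ => continuous_of_mem_chiSectionSpace_levelOfRecord L (ξ.bcη⁻¹ * μω) (finCongruenceLevel_le_integralLevel (↥(maximalRealSubfield L)) L (IsCMField.complexConj L) 3 ((StdForm.antidiagonal 3).over L) 𝔫) (isOpen_finCongruenceLevel (↥(maximalRealSubfield L)) L (IsCMField.complexConj L) 3 ((StdForm.antidiagonal 3).over L) h𝔫) hφ) μa μf bV hbc hbM h2 hc (antidiagonal_over_det_ne_zero L 3) ξ.ψ ξ.hψ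
    (fun T hT => (hE6_midWitness L μ νG ν h𝓕N h𝓕c h𝓕₀ hβ hμZ hφ₀V hφ₀c hφ₀M (levelOfRecord_le L (finCongruenceLevel (↥(maximalRealSubfield L)) L (IsCMField.complexConj L) 3 ((StdForm.antidiagonal 3).over L) 𝔫)) (archToAdelic_mem_levelOfRecord L (finCongruenceLevel (↥(maximalRealSubfield L)) L (IsCMField.complexConj L) 3 ((StdForm.antidiagonal 3).over L) 𝔫)) ((principalCongruenceLevel 3 L 𝔫).comap (GLn.ofFinite 3 L)) (isOpen_comap_ofFinite_principalCongruenceLevel 3 L h𝔫) (isCompact_comap_ofFinite_principalCongruenceLevel 3 L h𝔫) (fun _ hb => exists_mem_levelOfRecord_omegaOfRecord_eq_one L (ξ.bcη⁻¹ * μω) (1 : ↥(TorusDict.torus (IsCMField.complexConj L)) →ₜ* ℂˣ) (finCongruenceLevel_le_integralLevel (↥(maximalRealSubfield L)) L (IsCMField.complexConj L) 3 ((StdForm.antidiagonal 3).over L) 𝔫) hb) (fun _ hφ => continuous_of_mem_chiSectionSpace_levelOfRecord L (ξ.bcη⁻¹ * μω) (finCongruenceLevel_le_integralLevel (↥(maximalRealSubfield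 L)) L (IsCMField.complexConj L) 3 ((StdForm.antidiagonal 3).over L) 𝔫) (isOpen_finCongruenceLevel (↥(maximalRealSubfield L)) L (IsCMField.complexConj L) 3 ((StdForm.antidiagonal 3).over L) h𝔫) hφ) μa μf bV hbc hbM h2 hc (antidiagonal_over_det_ne_zero L 3) ξ.ψ ξ.hψ hT).imp fun _ h => h.2)
    (hMSP'_midWitness_of_unfolding L μ νG ν h𝓕N h𝓕c h𝓕₀ hβ hμZ hφ₀V hφ₀c hφ₀M (levelOfRecord_le L (finCongruenceLevel (↥(maximalRealSubfield L)) L (IsCMField.complexConj L) 3 ((StdForm.antidiagonal 3).over L) 𝔫)) (archToAdelic_mem_levelOfRecord L (finCongruenceLevel (↥(maximalRealSubfield L)) L (IsCMField.complexConj L) 3 ((StdForm.antidiagonal 3).over L) 𝔫)) ((principalCongruenceLevel 3 L 𝔫).comap (GLn.ofFinite 3 L)) (isOpen_comap_ofFinite_principalCongruenceLevel 3 L h𝔫) (isCompact_comap_ofFinite_principalCongruenceLevel 3 L h𝔫) (fun _ hb => exists_mem_levelOfRecord_omegaOfRecord_eq_one L (ξ.bcη⁻¹ * μω) (1 : ↥(TorusDict.torus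 (IsCMField.complexConj L)) →ₜ* ℂˣ) (finCongruenceLevel_le_integralLevel (↥(maximalRealSubfield L)) L (IsCMField.complexConj L) 3 ((StdForm.antidiagonal 3).over L) 𝔫) hb) (fun _ hφ => continuous_of_mem_chiSectionSpace_levelOfRecord L (ξ.bcη⁻¹ * μω) (finCongruenceLevel_le_integralLevel (↥(maximalRealSubfield L)) L (IsCMField.complexConj L) 3 ((StdForm.antidiagonal 3).over L) 𝔫) (isOpen_finCongruenceLevel (↥(maximalRealSubfield L)) L (IsCMField.complexConj L) 3 ((StdForm.antidiagonal 3).over L) h𝔫) hφ) μa μf bV hbc hbM h2 hc (antidiagonal_over_det_ne_zero L 3) ξ.ψ ξ.hψ μK νI h𝓕I h𝓕1 hχ₁ hρ₁ hχ₁ hρ₁ hS hurφ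
      HeckeCharacter.isUnitary_one (fun _ => rfl) S₀.finite_toSet (fun _ _ _ => rfl) hφ1 hunfK hreal) hMS32
  -- the right character of record as a monoid hom (★ p864091 `omegaOfRecord_one`, `omegaOfRecord_mul`)
  let ω₀ : ↥(levelOfRecord L (finCongruenceLevel (↥(maximalRealSubfield L)) L (IsCMField.complexConj L) 3 ((StdForm.antidiagonal 3).over L) 𝔫)) →* ℂ :=
    { toFun := (omegaOfRecord L (ξ.bcη⁻¹ * μω) (1 : ↥(TorusDict.torus (IsCMField.complexConj L)) →ₜ* ℂˣ) (finCongruenceLevel (↥(maximalRealSubfield L)) L (IsCMField.complexConj L) 3 ((StdForm.antidiagonal 3).over L) 𝔫))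
      map_one' := omegaOfRecord_one L (ξ.bcη⁻¹ * μω) (1 : ↥(TorusDict.torus (IsCMField.complexConj L)) →ₜ* ℂˣ) (finCongruenceLevel (↥(maximalRealSubfield L)) L (IsCMField.complexConj L) 3 ((StdForm.antidiagonal 3).over L) 𝔫)
      map_mul' := omegaOfRecord_mul L (ξ.bcη⁻¹ * μω) (1 : ↥(TorusDict.torus (IsCMField.complexConj L)) →ₜ* ℂˣ) (finCongruenceLevel (↥(maximalRealSubfield L)) L (IsCMField.complexConj L) 3 ((StdForm.antidiagonal 3).over L) 𝔫) }
  -- ROW (i′) BOUND (ED. 10): the `T = 1` (E6) family of ★ `hE6_midWitness`, twisted by `Θ = detChar ξ.ψ` through the multiplication operator, with its (MS-3∕2) bound from `hMS32`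
  obtain ⟨Fam₀, hFd₀, hFam₀⟩ := hE6_midWitness L μ νG ν h𝓕N h𝓕c h𝓕₀ hβ hμZ hφ₀V hφ₀c hφ₀M (levelOfRecord_le L (finCongruenceLevel (↥(maximalRealSubfield L)) L (IsCMField.complexConj L) 3 ((StdForm.antidiagonal 3).over L) 𝔫)) (archToAdelic_mem_levelOfRecord L (finCongruenceLevel (↥(maximalRealSubfield L)) L (IsCMField.complexConj L) 3 ((StdForm.antidiagonal 3).over L) 𝔫)) ((principalCongruenceLevel 3 L 𝔫).comap (GLn.ofFinite 3 L)) (isOpen_comap_ofFinite_principalCongruenceLevel 3 L h𝔫) (isCompact_comap_ofFinite_principalCongruenceLevel 3 L h𝔫) (fun _ hb => exists_mem_levelOfRecord_omegaOfRecord_eq_one L (ξ.bcη⁻¹ * μω) (1 : ↥(TorusDict.torus (IsCMField.complexConj L)) →ₜ* ℂˣ) (finCongruenceLevel_le_integralLevel (↥(maximalRealSubfield L)) L (IsCMField.complexConj L) 3 ((StdForm.antidiagonal 3).over L) 𝔫) hb) (fun _ hφ => continuous_of_mem_chiSectionSpace_levelOfRecord L (ξ.bcη⁻¹ * μω) (finCongruenceLevel_le_integralLevel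 (↥(maximalRealSubfield L)) L (IsCMField.complexConj L) 3 ((StdForm.antidiagonal 3).over L) 𝔫) (isOpen_finCongruenceLevel (↥(maximalRealSubfield L)) L (IsCMField.complexConj L) 3 ((StdForm.antidiagonal 3).over L) h𝔫) hφ) μa μf bV hbc hbM h2 hc (antidiagonal_over_det_ne_zero L 3) ξ.ψ ξ.hψ (T := 1) le_rfl
  have hΘinv : ∀ γ ∈ (quasiSplit (↥(maximalRealSubfield L)) L (IsCMField.complexConj L) 3).quotientSubgroup, ∀ g : (quasiSplit (↥(maximalRealSubfield L)) L (IsCMField.complexConj L) 3).Adelic,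
      (fun x => (((detChar (↥(maximalRealSubfield L)) L (IsCMField.complexConj L) h2 hc 3 ((StdForm.antidiagonal 3).over L) ξ.ψ ξ.hψ (antidiagonal_over_det_ne_zero L 3)) x : ℂˣ) : ℂ)) (γ * g) = (fun x => (((detChar (↥(maximalRealSubfield L)) L (IsCMField.complexConj L) h2 hc 3 ((StdForm.antidiagonal 3).over L) ξ.ψ ξ.hψ (antidiagonal_over_det_ne_zero L 3)) x : ℂˣ) : ℂ)) g :=
    fun γ hγ g => by
      show (((detChar (↥(maximalRealSubfield L)) L (IsCMField.complexConj L) h2 hc 3 ((StdForm.antidiagonal 3).over L) ξ.ψ ξ.hψ (antidiagonal_over_det_ne_zero L 3)) (γ * g) : ℂˣ) : ℂ) = (((detChar (↥(maximalRealSubfield L)) L (IsCMField.complexConj L) h2 hc 3 ((StdForm.antidiagonal 3).over L) ξ.ψ ξ.hψ (antidiagonal_over_det_ne_zero L 3)) g : ℂˣ) : ℂ)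
      rw [map_mul, (detChar (↥(maximalRealSubfield L)) L (IsCMField.complexConj L) h2 hc 3 ((StdForm.antidiagonal 3).over L) ξ.ψ ξ.hψ (antidiagonal_over_det_ne_zero L 3)).map_of_mem hγ, one_mul]
  obtain ⟨M, hM, hMn⟩ := exists_mulCLM_of_norm_le μ ((continuous_quotFun hΘinv (detChar (↥(maximalRealSubfield L)) L (IsCMField.complexConj L) h2 hc 3 ((StdForm.antidiagonal 3).over L) ξ.ψ ξ.hψ (antidiagonal_over_det_ne_zero L 3)).continuous).aestronglyMeasurable) (C := 1)
    (Eventually.of_forall fun x => ((detChar (↥(maximalRealSubfield L)) L (IsCMField.complexConj L) h2 hc 3 ((StdForm.antidiagonal 3).over L) ξ.ψ ξ.hψ (antidiagonal_over_det_ne_zero L 3)).norm_coe _).le)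
  have htw : ∀ z : ℂ, truncation ν 𝓕 1 (fun x => midWitnessEc L μ νG ν h𝓕N h𝓕c h𝓕₀ hβ hμZ hφ₀V hφ₀c hφ₀M (levelOfRecord_le L (finCongruenceLevel (↥(maximalRealSubfield L)) L (IsCMField.complexConj L) 3 ((StdForm.antidiagonal 3).over L) 𝔫)) (archToAdelic_mem_levelOfRecord L (finCongruenceLevel (↥(maximalRealSubfield L)) L (IsCMField.complexConj L) 3 ((StdForm.antidiagonal 3).over L) 𝔫)) ((principalCongruenceLevel 3 L 𝔫).comap (GLn.ofFinite 3 L)) (isOpen_comap_ofFinite_principalCongruenceLevel 3 L h𝔫) (isCompact_comap_ofFinite_principalCongruenceLevel 3 L h𝔫) (fun _ hb => exists_mem_levelOfRecord_omegaOfRecord_eq_one L (ξ.bcη⁻¹ * μω) (1 : ↥(TorusDict.torus (IsCMField.complexConj L)) →ₜ* ℂˣ) (finCongruenceLevel_le_integralLevel (↥(maximalRealSubfield L)) L (IsCMField.complexConj L) 3 ((StdForm.antidiagonal 3).over L) 𝔫) hb) (fun _ hφ => continuous_of_mem_chiSectionSpace_levelOfRecord L (ξ.bcη⁻¹ * μω)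 (finCongruenceLevel_le_integralLevel (↥(maximalRealSubfield L)) L (IsCMField.complexConj L) 3 ((StdForm.antidiagonal 3).over L) 𝔫) (isOpen_finCongruenceLevel (↥(maximalRealSubfield L)) L (IsCMField.complexConj L) 3 ((StdForm.antidiagonal 3).over L) h𝔫) hφ) μa μf bV hbc hbM h2 hc (antidiagonal_over_det_ne_zero L 3) ξ.ψ ξ.hψ z x * (((detChar (↥(maximalRealSubfield L)) L (IsCMField.complexConj L) h2 hc 3 ((StdForm.antidiagonal 3).over L) ξ.ψ ξ.hψ (antidiagonal_over_det_ne_zero L 3)) x : ℂˣ) : ℂ)) =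
      fun g => truncation ν 𝓕 1 (midWitnessEc L μ νG ν h𝓕N h𝓕c h𝓕₀ hβ hμZ hφ₀V hφ₀c hφ₀M (levelOfRecord_le L (finCongruenceLevel (↥(maximalRealSubfield L)) L (IsCMField.complexConj L) 3 ((StdForm.antidiagonal 3).over L) 𝔫)) (archToAdelic_mem_levelOfRecord L (finCongruenceLevel (↥(maximalRealSubfield L)) L (IsCMField.complexConj L) 3 ((StdForm.antidiagonal 3).over L) 𝔫)) ((principalCongruenceLevel 3 L 𝔫).comap (GLn.ofFinite 3 L)) (isOpen_comap_ofFinite_principalCongruenceLevel 3 L h𝔫) (isCompact_comap_ofFinite_principalCongruenceLevel 3 L h𝔫) (fun _ hb => exists_mem_levelOfRecord_omegaOfRecord_eq_one L (ξ.bcη⁻¹ * μω) (1 : ↥(TorusDict.torus (IsCMField.complexConj L)) →ₜ* ℂˣ) (finCongruenceLevel_le_integralLevel (↥(maximalRealSubfield L)) L (IsCMField.complexConj L) 3 ((StdForm.antidiagonal 3).over L) 𝔫) hb) (fun _ hφ => continuous_of_mem_chiSectionSpace_levelOfRecord L (ξ.bcη⁻¹ * μω) (finCongruenceLevel_le_integralLevel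 (↥(maximalRealSubfield L)) L (IsCMField.complexConj L) 3 ((StdForm.antidiagonal 3).over L) 𝔫) (isOpen_finCongruenceLevel (↥(maximalRealSubfield L)) L (IsCMField.complexConj L) 3 ((StdForm.antidiagonal 3).over L) h𝔫) hφ) μa μf bV hbc hbM h2 hc (antidiagonal_over_det_ne_zero L 3) ξ.ψ ξ.hψ z) g * (((detChar (↥(maximalRealSubfield L)) L (IsCMField.complexConj L) h2 hc 3 ((StdForm.antidiagonal 3).over L) ξ.ψ ξ.hψ (antidiagonal_over_det_ne_zero L 3)) g : ℂˣ) : ℂ) :=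
    fun z => funext fun g => truncation_mul_automorphicCharacter L (by norm_num) ν 𝓕 1 (detChar (↥(maximalRealSubfield L)) L (IsCMField.complexConj L) h2 hc 3 ((StdForm.antidiagonal 3).over L) ξ.ψ ξ.hψ (antidiagonal_over_det_ne_zero L 3)) (midWitnessEc L μ νG ν h𝓕N h𝓕c h𝓕₀ hβ hμZ hφ₀V hφ₀c hφ₀M (levelOfRecord_le L (finCongruenceLevel (↥(maximalRealSubfield L)) L (IsCMField.complexConj L) 3 ((StdForm.antidiagonal 3).over L) 𝔫)) (archToAdelic_mem_levelOfRecord L (finCongruenceLevel (↥(maximalRealSubfield L)) L (IsCMField.complexConj L) 3 ((StdForm.antidiagonal 3).over L) 𝔫)) ((principalCongruenceLevel 3 L 𝔫).comap (GLn.ofFinite 3 L)) (isOpen_comap_ofFinite_principalCongruenceLevel 3 L h𝔫) (isCompact_comap_ofFinite_principalCongruenceLevel 3 L h𝔫) (fun _ hb => exists_mem_levelOfRecord_omegaOfRecord_eq_one L (ξ.bcη⁻¹ * μω) (1 : ↥(TorusDict.torus (IsCMField.complexConj L)) →ₜ* ℂˣ) (finCongruenceLevel_le_integralLevel (↥(maximalRealSubfield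 L)) L (IsCMField.complexConj L) 3 ((StdForm.antidiagonal 3).over L) 𝔫) hb) (fun _ hφ => continuous_of_mem_chiSectionSpace_levelOfRecord L (ξ.bcη⁻¹ * μω) (finCongruenceLevel_le_integralLevel (↥(maximalRealSubfield L)) L (IsCMField.complexConj L) 3 ((StdForm.antidiagonal 3).over L) 𝔫) (isOpen_finCongruenceLevel (↥(maximalRealSubfield L)) L (IsCMField.complexConj L) 3 ((StdForm.antidiagonal 3).over L) h𝔫) hφ) μa μf bV hbc hbM h2 hc (antidiagonal_over_det_ne_zero L 3) ξ.ψ ξ.hψ z) g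
  have hFdΘ : DifferentiableOn ℂ (fun z => M (Fam₀ z)) (({z : ℂ | 1 < z.re} \ (↑({(3 : ℂ) / 2} : Finset ℂ) : Set ℂ)) ∩ (midWitnessP L μ νG ν h𝓕N h𝓕c h𝓕₀ hβ hμZ hφ₀V hφ₀c hφ₀M (levelOfRecord_le L (finCongruenceLevel (↥(maximalRealSubfield L)) L (IsCMField.complexConj L) 3 ((StdForm.antidiagonal 3).over L) 𝔫)) (archToAdelic_mem_levelOfRecord L (finCongruenceLevel (↥(maximalRealSubfield L)) L (IsCMField.complexConj L) 3 ((StdForm.antidiagonal 3).over L) 𝔫)) ((principalCongruenceLevel 3 L 𝔫).comap (GLn.ofFinite 3 L)) (isOpen_comap_ofFinite_principalCongruenceLevel 3 L h𝔫) (isCompact_comap_ofFinite_principalCongruenceLevel 3 L h𝔫) (fun _ hb => exists_mem_levelOfRecord_omegaOfRecord_eq_one L (ξ.bcη⁻¹ * μω) (1 : ↥(TorusDict.torus (IsCMField.complexConj L)) →ₜ* ℂˣ) (finCongruenceLevel_le_integralLevel (↥(maximalRealSubfield L)) L (IsCMField.complexConj L) 3 ((StdForm.antidiagonal 3).over L)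 𝔫) hb) (fun _ hφ => continuous_of_mem_chiSectionSpace_levelOfRecord L (ξ.bcη⁻¹ * μω) (finCongruenceLevel_le_integralLevel (↥(maximalRealSubfield L)) L (IsCMField.complexConj L) 3 ((StdForm.antidiagonal 3).over L) 𝔫) (isOpen_finCongruenceLevel (↥(maximalRealSubfield L)) L (IsCMField.complexConj L) 3 ((StdForm.antidiagonal 3).over L) h𝔫) hφ) μa μf bV hbc hbM h2 hc (antidiagonal_over_det_ne_zero L 3) ξ.ψ ξ.hψ)ᶜ) :=
    (M.differentiable.comp_differentiableOn hFd₀).mono Set.inter_subset_right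
  have hFamΘ : ∀ z ∈ (({z : ℂ | 1 < z.re} \ (↑({(3 : ℂ) / 2} : Finset ℂ) : Set ℂ)) ∩ (midWitnessP L μ νG ν h𝓕N h𝓕c h𝓕₀ hβ hμZ hφ₀V hφ₀c hφ₀M (levelOfRecord_le L (finCongruenceLevel (↥(maximalRealSubfield L)) L (IsCMField.complexConj L) 3 ((StdForm.antidiagonal 3).over L) 𝔫)) (archToAdelic_mem_levelOfRecord L (finCongruenceLevel (↥(maximalRealSubfield L)) L (IsCMField.complexConj L) 3 ((StdForm.antidiagonal 3).over L) 𝔫)) ((principalCongruenceLevel 3 L 𝔫).comap (GLn.ofFinite 3 L)) (isOpen_comap_ofFinite_principalCongruenceLevel 3 L h𝔫) (isCompact_comap_ofFinite_principalCongruenceLevel 3 L h𝔫) (fun _ hb => exists_mem_levelOfRecord_omegaOfRecord_eq_one L (ξ.bcη⁻¹ * μω) (1 : ↥(TorusDict.torus (IsCMField.complexConj L)) →ₜ* ℂˣ) (finCongruenceLevel_le_integralLevel (↥(maximalRealSubfield L)) L (IsCMField.complexConj L) 3 ((StdForm.antidiagonal 3).over L) 𝔫) hb) (fun _ hφ =>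 continuous_of_mem_chiSectionSpace_levelOfRecord L (ξ.bcη⁻¹ * μω) (finCongruenceLevel_le_integralLevel (↥(maximalRealSubfield L)) L (IsCMField.complexConj L) 3 ((StdForm.antidiagonal 3).over L) 𝔫) (isOpen_finCongruenceLevel (↥(maximalRealSubfield L)) L (IsCMField.complexConj L) 3 ((StdForm.antidiagonal 3).over L) h𝔫) hφ) μa μf bV hbc hbM h2 hc (antidiagonal_over_det_ne_zero L 3) ξ.ψ ξ.hψ)ᶜ),
      ((M (Fam₀ z) : Lp ℂ 2 μ) : (quasiSplit (↥(maximalRealSubfield L)) L (IsCMField.complexConj L) 3).automorphicQuotient → ℂ) =ᵐ[μ] (quasiSplit (↥(maximalRealSubfield L)) L (IsCMField.complexConj L) 3).quotFun (truncation ν 𝓕 1 (fun x => midWitnessEc L μ νG ν h𝓕N h𝓕c h𝓕₀ hβ hμZ hφ₀V hφ₀c hφ₀M (levelOfRecord_le L (finCongruenceLevel (↥(maximalRealSubfield L)) L (IsCMField.complexConj L) 3 ((StdForm.antidiagonal 3).over L) 𝔫)) (archToAdelic_mem_levelOfRecord L (finCongruenceLevel (↥(maximalRealSubfield L)) L (IsCMField.complexConj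 L) 3 ((StdForm.antidiagonal 3).over L) 𝔫)) ((principalCongruenceLevel 3 L 𝔫).comap (GLn.ofFinite 3 L)) (isOpen_comap_ofFinite_principalCongruenceLevel 3 L h𝔫) (isCompact_comap_ofFinite_principalCongruenceLevel 3 L h𝔫) (fun _ hb => exists_mem_levelOfRecord_omegaOfRecord_eq_one L (ξ.bcη⁻¹ * μω) (1 : ↥(TorusDict.torus (IsCMField.complexConj L)) →ₜ* ℂˣ) (finCongruenceLevel_le_integralLevel (↥(maximalRealSubfield L)) L (IsCMField.complexConj L) 3 ((StdForm.antidiagonal 3).over L) 𝔫) hb) (fun _ hφ => continuous_of_mem_chiSectionSpace_levelOfRecord L (ξ.bcη⁻¹ * μω) (finCongruenceLevel_le_integralLevel (↥(maximalRealSubfield L)) L (IsCMField.complexConj L) 3 ((StdForm.antidiagonal 3).over L) 𝔫) (isOpen_finCongruenceLevel (↥(maximalRealSubfield L)) L (IsCMField.complexConj L) 3 ((StdForm.antidiagonal 3).over L) h𝔫) hφ) μa μf bV hbc hbM h2 hc (antidiagonal_over_det_ne_zero L 3) ξ.ψ ξ.hψ z x * (((detChar (↥(maximalRealSubfield L)) L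 (IsCMField.complexConj L) h2 hc 3 ((StdForm.antidiagonal 3).over L) ξ.ψ ξ.hψ (antidiagonal_over_det_ne_zero L 3)) x : ℂˣ) : ℂ))) := by
    intro z hz
    rw [htw z]
    filter_upwards [hM (Fam₀ z), hFam₀ z hz.2] with x hx hfx
    rw [hx, hfx, quotFun_mul, mul_comm]
  have hMSΘ : ∃ C : ℝ, ∀ᶠ z in 𝓝[≠] ((3 : ℂ) / 2), ‖(z - (3 : ℂ) / 2) • M (Fam₀ z)‖ ≤ C := by
    obtain ⟨C, hC⟩ := hMS32 1 le_rfl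
    refine ⟨max 1 0 * C, ?_⟩
    filter_upwards [hC, hPcd' ((3 : ℂ) / 2)] with z hz hzP
    have h1 : ‖Fam₀ z‖ = (eLpNorm ((quasiSplit (↥(maximalRealSubfield L)) L (IsCMField.complexConj L) 3).quotFun (truncation ν 𝓕 1 (midWitnessEc L μ νG ν h𝓕N h𝓕c h𝓕₀ hβ hμZ hφ₀V hφ₀c hφ₀M (levelOfRecord_le L (finCongruenceLevel (↥(maximalRealSubfield L)) L (IsCMField.complexConj L) 3 ((StdForm.antidiagonal 3).over L) 𝔫)) (archToAdelic_mem_levelOfRecord L (finCongruenceLevel (↥(maximalRealSubfield L)) L (IsCMField.complexConj L) 3 ((StdForm.antidiagonal 3).over L) 𝔫)) ((principalCongruenceLevel 3 L 𝔫).comap (GLn.ofFinite 3 L)) (isOpen_comap_ofFinite_principalCongruenceLevel 3 L h𝔫) (isCompact_comap_ofFinite_principalCongruenceLevel 3 L h𝔫) (fun _ hb => exists_mem_levelOfRecord_omegaOfRecord_eq_one L (ξ.bcη⁻¹ * μω) (1 : ↥(TorusDict.torus (IsCMField.complexConj L)) →ₜ* ℂˣ) (finCongruenceLevel_le_integralLevel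 (↥(maximalRealSubfield L)) L (IsCMField.complexConj L) 3 ((StdForm.antidiagonal 3).over L) 𝔫) hb) (fun _ hφ => continuous_of_mem_chiSectionSpace_levelOfRecord L (ξ.bcη⁻¹ * μω) (finCongruenceLevel_le_integralLevel (↥(maximalRealSubfield L)) L (IsCMField.complexConj L) 3 ((StdForm.antidiagonal 3).over L) 𝔫) (isOpen_finCongruenceLevel (↥(maximalRealSubfield L)) L (IsCMField.complexConj L) 3 ((StdForm.antidiagonal 3).over L) h𝔫) hφ) μa μf bV hbc hbM h2 hc (antidiagonal_over_det_ne_zero L 3) ξ.ψ ξ.hψ z))) 2 μ).toReal := by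
      rw [Lp.norm_def, eLpNorm_congr_ae (hFam₀ z hzP)]
    rw [norm_smul]
    calc ‖z - (3 : ℂ) / 2‖ * ‖M (Fam₀ z)‖ ≤ ‖z - (3 : ℂ) / 2‖ * (max 1 0 * ‖Fam₀ z‖) := mul_le_mul_of_nonneg_left (hMn _) (norm_nonneg _)
      _ = max 1 0 * (‖z - (3 : ℂ) / 2‖ * (eLpNorm ((quasiSplit (↥(maximalRealSubfield L)) L (IsCMField.complexConj L) 3).quotFun (truncation ν 𝓕 1 (midWitnessEc L μ νG ν h𝓕N h𝓕c h𝓕₀ hβ hμZ hφ₀V hφ₀c hφ₀M (levelOfRecord_le L (finCongruenceLevel (↥(maximalRealSubfield L)) L (IsCMField.complexConj L) 3 ((StdForm.antidiagonal 3).over L) 𝔫)) (archToAdelic_mem_levelOfRecord L (finCongruenceLevel (↥(maximalRealSubfield L)) L (IsCMField.complexConj L) 3 ((StdForm.antidiagonal 3).over L) 𝔫)) ((principalCongruenceLevel 3 L 𝔫).comap (GLn.ofFinite 3 L)) (isOpen_comap_ofFinite_principalCongruenceLevel 3 L h𝔫) (isCompact_comap_ofFinite_principalCongruenceLevel 3 L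 h𝔫) (fun _ hb => exists_mem_levelOfRecord_omegaOfRecord_eq_one L (ξ.bcη⁻¹ * μω) (1 : ↥(TorusDict.torus (IsCMField.complexConj L)) →ₜ* ℂˣ) (finCongruenceLevel_le_integralLevel (↥(maximalRealSubfield L)) L (IsCMField.complexConj L) 3 ((StdForm.antidiagonal 3).over L) 𝔫) hb) (fun _ hφ => continuous_of_mem_chiSectionSpace_levelOfRecord L (ξ.bcη⁻¹ * μω) (finCongruenceLevel_le_integralLevel (↥(maximalRealSubfield L)) L (IsCMField.complexConj L) 3 ((StdForm.antidiagonal 3).over L) 𝔫) (isOpen_finCongruenceLevel (↥(maximalRealSubfield L)) L (IsCMField.complexConj L) 3 ((StdForm.antidiagonal 3).over L) h𝔫) hφ) μa μf bV hbc hbM h2 hc (antidiagonal_over_det_ne_zero L 3) ξ.ψ ξ.hψ z))) 2 μ).toReal) := by rw [h1]; ring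
      _ ≤ max 1 0 * C := mul_le_mul_of_nonneg_left hz (le_max_right _ _)
  -- THE EULER FACTORISATION (ED. 13): ★ p864823 from the unfolding letter on `K_max`
  obtain ⟨a, ha, hQ'⟩ := exists_eulerFactorisation_midWitness L μ νG ν h𝓕N h𝓕c h𝓕₀ hβ hμZ hφ₀V hφ₀c hφ₀M (levelOfRecord_le L (finCongruenceLevel (↥(maximalRealSubfield L)) L (IsCMField.complexConj L) 3 ((StdForm.antidiagonal 3).over L) 𝔫)) (archToAdelic_mem_levelOfRecord L (finCongruenceLevel (↥(maximalRealSubfield L)) L (IsCMField.complexConj L) 3 ((StdForm.antidiagonal 3).over L) 𝔫)) ((principalCongruenceLevel 3 L 𝔫).comap (GLn.ofFinite 3 L)) (isOpen_comap_ofFinite_principalCongruenceLevel 3 L h𝔫) (isCompact_comap_ofFinite_principalCongruenceLevel 3 L h𝔫) (fun _ hb => exists_mem_levelOfRecord_omegaOfRecord_eq_one L (ξ.bcη⁻¹ * μω) (1 : ↥(TorusDict.torus (IsCMField.complexConj L)) →ₜ* ℂˣ) (finCongruenceLevel_le_integralLevel (↥(maximalRealSubfield L)) L (IsCMField.complexConj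 L) 3 ((StdForm.antidiagonal 3).over L) 𝔫) hb) (fun _ hφ => continuous_of_mem_chiSectionSpace_levelOfRecord L (ξ.bcη⁻¹ * μω) (finCongruenceLevel_le_integralLevel (↥(maximalRealSubfield L)) L (IsCMField.complexConj L) 3 ((StdForm.antidiagonal 3).over L) 𝔫) (isOpen_finCongruenceLevel (↥(maximalRealSubfield L)) L (IsCMField.complexConj L) 3 ((StdForm.antidiagonal 3).over L) h𝔫) hφ) μa μf bV hbc hbM h2 hc (antidiagonal_over_det_ne_zero L 3) ξ.ψ ξ.hψ h𝓕1 hunfK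
  -- ROW (ii) BOUND (ED. 12): §1 at the named family (`Θ := detChar ξ.ψ`, `b_j := bV_j`, `χ₂ := 1`)
  obtain ⟨ψ, φt, q, qc, hE3, hqcq', hqa', hfac, hφt, hg₀, hφtbd, hqsrc⟩ := rowTwo_of_coordRoad L ν h𝓕N h𝓕c (detChar (↥(maximalRealSubfield L)) L (IsCMField.complexConj L) h2 hc 3 ((StdForm.antidiagonal 3).over L) ξ.ψ ξ.hψ (antidiagonal_over_det_ne_zero L 3))
    (IsChiSection.isChiSectionPair_of_trivial (one_apply_torus (IsCMField.complexConj L)) (isChiSection_of_mem hφ₀V)) hφ₀c hφ₀M _ hE2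
    (fun j => ((bV j : ↥(chiSectionSpace (reflectChar (IsCMField.complexConj L) (ξ.bcη⁻¹ * μω)) (levelOfRecord L (finCongruenceLevel (↥(maximalRealSubfield L)) L (IsCMField.complexConj L) 3 ((StdForm.antidiagonal 3).over L) 𝔫)) (omegaOfRecord L (ξ.bcη⁻¹ * μω) (1 : ↥(TorusDict.torus (IsCMField.complexConj L)) →ₜ* ℂˣ) (finCongruenceLevel (↥(maximalRealSubfield L)) L (IsCMField.complexConj L) 3 ((StdForm.antidiagonal 3).over L) 𝔫)))) : (quasiSplit (↥(maximalRealSubfield L)) L (IsCMField.complexConj L) 3).Adelic → ℂ)) hbM _ _ hqφ hqcq hPc hPcd' hqcan hEΘdiff hEΘ4 hEΘbd _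
    (differentiableOn_amplitude_shifted_midBlock L hcδ hδ hd 𝔫 νv μE₁ μF₁ ξ kμ ε hε1 S₀ C)
    (hA32_shifted_of_record_at_basePoint_of_modEq L hcδ hδ 𝔫 νv μE₁ μF₁ ξ kμ hk ε hε1 hε0 S₀ hC)
    (fun z : ℂ => ((partialStandardL {w : HeightOneSpectrum (𝓞 L) | w.under (𝓞 ↥(maximalRealSubfield L)) ∈ (↑S₀ : Set (HeightOneSpectrum (𝓞 ↥(maximalRealSubfield L))))} (fun w => {(ξ.bcη⁻¹ * μω).valueAtUniformizer w}) (z - 1) * partialStandardL (↑S₀ : Set (HeightOneSpectrum (𝓞 ↥(maximalRealSubfield L)))) (fun v => {(1 : HeckeCharacter ↥(maximalRealSubfield L)).valueAtUniformizer v}) (2 * z - 2)) /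
            (partialStandardL {w : HeightOneSpectrum (𝓞 L) | w.under (𝓞 ↥(maximalRealSubfield L)) ∈ (↑S₀ : Set (HeightOneSpectrum (𝓞 ↥(maximalRealSubfield L))))} (fun w => {(ξ.bcη⁻¹ * μω).valueAtUniformizer w}) z * partialStandardL (↑S₀ : Set (HeightOneSpectrum (𝓞 ↥(maximalRealSubfield L)))) (fun v => {(1 : HeckeCharacter ↥(maximalRealSubfield L)).valueAtUniformizer v}) (2 * z - 1))))
    g₁ a ha (fun z hz j => by rw [hQ' j z hz, mul_comm])
    -- ED. 16: the coordinate form of `hsrc` at `g₁` read from the basis-free binder through the exports' clause 2 (`Σ_j Q_j(z)•bV_j = (ν𝓕)⁻¹•(∫_N f_z(w₀v·))·H^{z−2}`, `ν 𝓕 = 1`)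
    (fun z hz => by
      have h := congrFun (hqφ z hz) g₁
      rw [h𝓕1, ENNReal.toReal_one, inv_one, Complex.ofReal_one, one_smul, Finset.sum_apply] at h
      simp only [Pi.smul_apply, smul_eq_mul] at h
      have e := hsrc z hz
      rw [← h, Finset.sum_mul] at e
      exact Eq.trans (Finset.sum_congr rfl fun j _ => by ring) e)
  exact resGMidBlock_ne_bot_of_ledger_letters L μ μω hμu hμω ξ νG ν h𝓕N h𝓕c h𝓕₀ hβ hμZ μa μf h2 hc (antidiagonal_over_det_ne_zero L 3) (levelOfRecord L (finCongruenceLevel (↥(maximalRealSubfield L)) L (IsCMField.complexConj L) 3 ((StdForm.antidiagonal 3).over L) 𝔫)) ω₀ hφ₀V hφ₀c hφ₀M (levelOfRecord_le L (finCongruenceLevel (↥(maximalRealSubfield L)) L (IsCMField.complexConj L) 3 ((StdForm.antidiagonal 3).over L) 𝔫))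
    (archToAdelic_mem_levelOfRecord L (finCongruenceLevel (↥(maximalRealSubfield L)) L (IsCMField.complexConj L) 3 ((StdForm.antidiagonal 3).over L) 𝔫)) ((principalCongruenceLevel 3 L 𝔫).comap (GLn.ofFinite 3 L)) (isOpen_comap_ofFinite_principalCongruenceLevel 3 L h𝔫) (isCompact_comap_ofFinite_principalCongruenceLevel 3 L h𝔫) (fun _ hb => exists_mem_levelOfRecord_omegaOfRecord_eq_one L (ξ.bcη⁻¹ * μω) (1 : ↥(TorusDict.torus (IsCMField.complexConj L)) →ₜ* ℂˣ) (finCongruenceLevel_le_integralLevel (↥(maximalRealSubfield L)) L (IsCMField.complexConj L) 3 ((StdForm.antidiagonal 3).over L) 𝔫) hb)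
    (fun _ hφ => continuous_of_mem_chiSectionSpace_levelOfRecord L (ξ.bcη⁻¹ * μω) (finCongruenceLevel_le_integralLevel (↥(maximalRealSubfield L)) L (IsCMField.complexConj L) 3 ((StdForm.antidiagonal 3).over L) 𝔫) (isOpen_finCongruenceLevel (↥(maximalRealSubfield L)) L (IsCMField.complexConj L) 3 ((StdForm.antidiagonal 3).over L) h𝔫) hφ) bV hbc hbM hbddPK hbdd32
    hDo hD Set.inter_subset_left ψ φt (fun z _ g => hE3 z g) q qc hqcq' hPcd' hqa' hfac hφt hg₀ hφtbd
    hS hurφ S₀.finite_toSet (fun _ _ _ => rfl)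
    (fun z : ℂ => (C * ∏ v ∈ S₀, ((Measure.pi fun _ : Fin 3 => νv v) (integralBox ↥(maximalRealSubfield L) (Fin 3) v)).toReal⁻¹ •
            ∫ p : Fin 3 → v.adicCompletion ↥(maximalRealSubfield L),
              Set.indicator {p : Fin 3 → v.adicCompletion ↥(maximalRealSubfield L) | p ∈ integralBox ↥(maximalRealSubfield L) (Fin 3) v ∧ ∀ w' : PlacesOver L v,
                  Valued.v (quadraticLocalEquiv L v (IsCMField.complexConj L) hcδ hδ (p 0, p 1) w') ≤ idealRadius L w'.1 𝔫 ∧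
                  Valued.v (conjLocal L (IsCMField.complexConj L) v (quadraticLocalEquiv L v (IsCMField.complexConj L) hcδ hδ (p 0, p 1)) w') ≤ idealRadius L w'.1 𝔫 ∧
                  Valued.v ((toLocalRing L v (p 2) * algebraMap L (LocalRing L v) δ -
                    toLocalRing L v 2⁻¹ * (quadraticLocalEquiv L v (IsCMField.complexConj L) hcδ hδ (p 0, p 1) * conjLocal L (IsCMField.complexConj L) v (quadraticLocalEquiv L v (IsCMField.complexConj L) hcδ hδ (p 0, p 1)))) w') ≤ idealRadius L w'.1 𝔫}
                (fun _ => (1 : ℂ)) p *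
              (((∏ w' : PlacesOver L v, max 1 (max ((normAbs (w'.1.adicCompletion L) (quadraticLocalEquiv L v (IsCMField.complexConj L) hcδ hδ (p 0, p 1) w') : ℝ≥0) : ℝ)
                ((normAbs (w'.1.adicCompletion L) ((toLocalRing L v (p 2) * algebraMap L (LocalRing L v) δ -
                  toLocalRing L v 2⁻¹ * (quadraticLocalEquiv L v (IsCMField.complexConj L) hcδ hδ (p 0, p 1) *
                    conjLocal L (IsCMField.complexConj L) v (quadraticLocalEquiv L v (IsCMField.complexConj L) hcδ hδ (p 0, p 1)))) w') : ℝ≥0) : ℝ))) : ℝ) : ℂ) ^ (-z) ∂(Measure.pi fun _ : Fin 3 => νv v)) *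
          ∫ Xi : InfiniteAdeleRing L, ∫ a : InfiniteAdeleRing ↥(maximalRealSubfield L),
          (∏ w : InfinitePlace L, ε w * archUnitaryValue (kμ w - 2 * ξ.eη w) 0 ((((-(1 + ‖Xi w‖ ^ 2 / 2)) : ℝ) : ℂ) + (((w.embedding δ).im * ((InfiniteAdeleRing.ringEquiv_mixedSpace ↥(maximalRealSubfield L)) a).1 ⟨w.comap (algebraMap ↥(maximalRealSubfield L) L), Summit.HodgeConjecture.HodgeConjecture.Cruxes.H413.K2E1HeightBigCellLineFormulaU2.isReal_comap_maximalRealSubfield L w⟩ : ℝ) : ℂ) * Complex.I) * (((2 : ℂ) + ((((-(1 + ‖Xi w‖ ^ 2 / 2)) : ℝ) : ℂ) + (((w.embedding δ).im * ((InfiniteAdeleRing.ringEquiv_mixedSpace ↥(maximalRealSubfield L)) a).1 ⟨w.comap (algebraMap ↥(maximalRealSubfield L) L), Summit.HodgeConjecture.HodgeConjecture.Cruxes.H413.K2E1HeightBigCellLineFormulaU2.isReal_comap_maximalRealSubfield L w⟩ : ℝ) : ℂ) * Complex.I)) / ((((-(1 + ‖Xi w‖ ^ 2 / 2)) : ℝ)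 : ℂ) + (((w.embedding δ).im * ((InfiniteAdeleRing.ringEquiv_mixedSpace ↥(maximalRealSubfield L)) a).1 ⟨w.comap (algebraMap ↥(maximalRealSubfield L) L), Summit.HodgeConjecture.HodgeConjecture.Cruxes.H413.K2E1HeightBigCellLineFormulaU2.isReal_comap_maximalRealSubfield L w⟩ : ℝ) : ℂ) * Complex.I)) ^ (((kμ w - 2 * ξ.eη w) - 1) / 2).toNat * (((2 : ℂ) + conj ((((-(1 + ‖Xi w‖ ^ 2 / 2)) : ℝ) : ℂ) + (((w.embedding δ).im * ((InfiniteAdeleRing.ringEquiv_mixedSpace ↥(maximalRealSubfield L)) a).1 ⟨w.comap (algebraMap ↥(maximalRealSubfield L) L), Summit.HodgeConjecture.HodgeConjecture.Cruxes.H413.K2E1HeightBigCellLineFormulaU2.isReal_comap_maximalRealSubfield L w⟩ : ℝ) : ℂ) * Complex.I)) / conj ((((-(1 + ‖Xi w‖ ^ 2 / 2)) : ℝ) : ℂ) + (((w.embedding δ).im * ((InfiniteAdeleRing.ringEquiv_mixedSpace ↥(maximalRealSubfield L)) a).1 ⟨w.comap (algebraMap ↥(maximalRealSubfield L) L), Summit.HodgeConjecture.HodgeConjecture.Cruxes.H413.K2E1HeightBigCellLineFormulaU2.isReal_comap_maximalRealSubfield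 L w⟩ : ℝ) : ℂ) * Complex.I)) ^ ((-(kμ w - 2 * ξ.eη w) - 1) / 2).toNat) *
            ((((∏ w : InfinitePlace L, ((1 + ‖(Xi) w‖ ^ 2 / 2) ^ 2 + (w δ) ^ 2 * (((InfiniteAdeleRing.ringEquiv_mixedSpace ↥(maximalRealSubfield L)) a).1 ⟨w.comap (algebraMap ↥(maximalRealSubfield L) L), Summit.HodgeConjecture.HodgeConjecture.Cruxes.H413.K2E1HeightBigCellLineFormulaU2.isReal_comap_maximalRealSubfield L w⟩) ^ 2))) : ℝ) : ℂ) ^ (-z) ∂μF₁ ∂μE₁)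
    (differentiableOn_amplitude_shifted_midBlock L hcδ hδ hd 𝔫 νv μE₁ μF₁ ξ kμ ε hε1 S₀ C) hqsrc
    (hA32_shifted_of_record_at_basePoint_of_modEq L hcδ hδ 𝔫 νv μE₁ μF₁ ξ kμ hk ε hε1 hε0 S₀ hC)
    (le_rfl : (1 : ℝ≥0) ≤ 1) (fun z => M (Fam₀ z)) hFdΘ hFamΘ hMSΘ

end Summit.HodgeConjecture.HodgeConjecture.R90.S8

end
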